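/-
Copyright: lit-balaban Phase-2 proof seat p08 (gen 9).  Statement-level skeleton of a published paper; no proof claims beyond what
the kernel checks below.
-/
import Literature.MathematicalPhysics.QuantumFieldTheory.BalabanImbrieJaffe1984to88.BIJ88OpCloseDkLocTorus

/-!
# `BalabanImbrieJaffe1984to88.BIJ88OpCloseDkLocGradTorus` — T. Bałaban, J. Imbrie, A. Jaffe, *Effective action and cluster properties of
the abelian Higgs model*, Commun. Math. Phys. **114** (1988) 257–315 [BalabanImbrieJaffe1988], Sect. 2 p. 261 [PDF 5] with p. 282 [PDF 26]:
**THE `η`-DERIVATIVE OF THE OPERATOR CLOSENESS `𝒟_{k,loc} ≈ 𝒟_k` FOR THE CONCRETE OBJECTS OF RECORD** — the companion of this seat's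
`BIJ88OpCloseDkLocTorus` (value member) in the shape used on p. 282 for `∂w′₁` (*"and similarly for ∂w′₁, ∂*w′₁"* after the UNNUMBERED
`w′₁`-display following (5.4.3); v1.1 (p08 gen 10, 2026-08-22): docstring-only — this display was cited as «(5.4.7)», which is the `w₂` bound on
the same page; ref-5 L-g34 (b), lead relay 2026-08-22T02:11:37Z; declarations byte-identical to v1; v1.2 (same seat): + §5
`one_le_rSched`, `opCloseGrad_dkLoc_torus_rSched`, `opCloseGrad_dkLoc_allTori_rSched` — §§3–4 at the PRINTED schedule `r(e_j)` with `ρ₀ = 1`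
for `log e_k⁻¹ ≥ 1`, append-only): for the `η^d`-weighted action,
`L^k·|((𝒟_k − 𝒟_{k,loc})f)(⟨x+e_λ,μ⟩) − ((𝒟_k − 𝒟_{k,loc})f)(⟨x,μ⟩)| ≤ c₀e^{−cρ_k}e^{−δ′dist_k(suppt f,⟨x,μ⟩)}‖f‖_∞` for ALL `x, μ, λ`, NO threshold,
uniformly in `k ≤ m + K`, for radius schedules bounded below (`ρ_j ≥ ρ₀ > 0`) and non-increasing below `k`; per torus with NO hypothesis and
over all tori (one set of constants) hypothesis-free.

statement-level skeleton of published theorems with citation tags; proofs where landed; nothing here is a claim about the Yang–Mills mass gap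

PDF held: `paper:balaban1988-cmp114-bij-abelian-higgs-effective-action` (journal page = PDF page + 256), p. 261 [PDF 5], p. 282 [PDF 26].

CITATION HEADER (lean-in-tree rule).  Part of the lit-balaban TYPED SKELETON (HOME `run/shared/lean/pub/lit-balaban/`), Phase-2 proof seat
p08 (gen 9), unit `lit-balaban-p08`; free-target protocol G.5-34(d), TAKING line HOME/STATUS.md (item (I2)).  WHAT IS REPRODUCED = SKELETON
row **C2.Eq2.13** (owner r18, referee ref-5), third p. 261 clause *"𝒟_{k,loc} is close to 𝒟_k"* combined with *"similarly for derivatives"*,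
kind «model instance», OPERATOR form with one output derivative; it is the `∂(𝒟_k − 𝒟_{k,loc})` input of r16's row C2.Eq5.4.7 (`∂w′₁`), whose
dressing with `∂*ε*δΠ` is NOT done here.  Decls used BY NAME (nothing restated): r18's `BIJ88CurlyDkLocCloseTorus.dk_sub_dkLoc_eq_sum` /
`abs_hKer_sub_hlKer_le` / `abs_cKer_sub_clKer_ambient_le` / `cSide_of_cloc_estimates`, `BIJ88CurlyDkLocTorus` (`hKer`, `hlKer`, `hlKer_apply`,
`hdist`, `cKer`, `clKer`, `dkLocKer`, `kdist`, `cKer_ambient_eq`); this seat's `BIJ88CurlyDkLocGradTerm.abs_hlKer_shift_sub_le` /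
`abs_cutoff_shift_sub_le` / `abs_distEU_shift_sub_le` / `exists_cutoffProfile_lipschitz`, `BIJ88OpDecay213DkLocGradTorus.weighted_rowsum_triple_le₂` /
`applyK_shift_sub`, `BIJ88OpDecay213DkLocTorus.abs_applyK_le_of_weighted_rowsum` / `eta_pow_scaling`, `BIJ88CurlyDkLocDecayTorus.abs_hlKer_le_of_sup` /
`abs_clKer_ambient_le`, `BIJ88Decay223CkAllTori.exists_HB_allTori_of_prop12Printed`; p08 g7's `ofLp_HkE_single` / `exists_bound_of_ineq722` /
`torusKernelData_gradH`; p13's `cutoffProfile_eq_one` / `cutoff_nonneg` / `cutoff_le_one`; p09's `cloc_estimates`, `ineq722_deltaA_of_prop12Printed`;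
p16's `prop12Printed_levStd_deltaA`; p19's `prop12Printed_allTori`.

THE PRINTED TEXT (verbatim).  p. 261: *"|(𝒟_{k,loc}f)(b)| ≦ ce^{−c dist(suppt f,b)}‖f‖_∞ (2.13) and similarly for derivatives of 𝒟_{k,loc} …
and 𝒟_{k,loc} is close to 𝒟_k, see (5.4.3) below."*; p. 282: *"The kernels of these operators can easily be bounded using the regularity and
exponential decay of H_j, H_{j,loc}, along with (2.7) and scaling properties. We obtain, for example, |(∂w′₁)(p,b′)| ≦ Σ_{j=1}^{k−1}
(L^jη)^{−1−(d−2)−1+(d−2)}e^{−cr(e_j)}e^{−c dist(p,b′)} ≦ e^{−cr(e_k)}e^{−c dist(p,b′)}"*.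

THE MECHANISM.  Per scale only the first kernel depends on the output point; with `g = Δ_λH_j`, `g_l = Δ_λH_{j,loc}`:
`Δ_λ[H C H − H_lC_lH_l] = (g − g_l)CH + g_l(C − C_l)H + g_lC_l(H − H_l)`.  The new small factor is `g − g_l = Δ_λ((1 − ζ_j)H_j)`: it vanishes
where both points are within `ρ_j/16` of `b₁` (`ζ_j = 1`), and elsewhere `dist ≥ ρ_j/16 − 1` gives `|Δ_λ((1−ζ_j)H_j)| ≤
L^{−j}M(1 + 16C_σ/ρ_j)e^{δ/2}e^{−(δ/2)(ρ_j/16)}e^{−(δ/2)dist}` (gradient member of (I.7.2.2) + slope of `ζ_j`); the other first-slot factor is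
`|Δ_λH_{j,loc}| ≤ L^{−j}M(1 + 16C_σ/ρ_j)e^{−δ dist}` (file E1).  Row sums: `η_k^dL^k·L^{−j}(L^{k−j})^{d−2}(L^j)^d = (L^{k−j})^{−1}`, summable.

WHAT IS PROVED (0 `sorry`, standard axioms; theorems only — proof lane; every `d ≥ 2`):
* §1 `abs_hKer_shift_sub_le` (the gradient member for r18's `hKer`), **`abs_grad_hKer_sub_hlKer_le`** (`Δ_λ(H_j − H_{j,loc})`, (2.7)-type
  smallness `e^{δ/2}e^{−(δ/2)R₁}`).
* §2 **`weighted_rowsum_gradDiffTerm_le`** (scale `j`: `≤ (1 + 16C_σ/r)((e^{δ/2} + 1)e^{−(δ/2)(r/16)} + e^{−(δ_C/4)r})M²M_C·d³e^{a/2}K(a)³·(L^{k−j})^{−1}`,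
  `a = min(δ/2,δ_C)/2`), **`weighted_rowsum_gradDkSubDkLoc_le`** (`≤ (1 + 16C_σ/ρ₀)(e^{δ/2} + 2)M²M_C·d³e^{a/2}K(a)³·e^{−cρ_k}`, `c = min(δ/32,δ_C/4)`).
* §3 **`abs_apply_gradDkSubDkLoc_le`** (explicit, ALL `x, μ, λ`), `opCloseGrad_dkLoc_of_ineq722`, **`opCloseGrad_dkLoc_torus`** (NO HYPOTHESIS),
  **`opCloseGrad_dkLoc_allTori_of_prop12Printed`**, **`opCloseGrad_dkLoc_allTori`** (HYPOTHESIS-FREE over all tori, ONE `(c₀, c, δ′)`).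
HONEST SCOPE.  (i) `η^d`-weighted action (reading of `BIJ88OpDecay213DkLocTorus`); one forward `η`-difference in the OUTPUT variable times
`η⁻¹ = L^k`; no `∂*ε*δΠ` dressing (row C2.Eq5.4.7 is r16's), no Hölder member (see the seat's note on the sup-norm cutoff).  (ii) Constants
depend on the lower bound `ρ₀` of the radii (`16C_σ/ρ₀`, `C_σ` an existential slope constant of `Real.smoothTransition`); smallness `e^{−cρ_k}`
needs the schedule non-increasing below `k` (displayed as hypotheses).  (iii) `U = 1`, real abelian fields, torus, standing range.  (iv) No
`def`, no new named fact, nothing restated; NOT summit progress.  Unit `lit-balaban-p08` (literature-prover-lit-balaban-p08-g9-0), 2026-08-21.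
-/

open scoped BigOperators RealInnerProductSpace

namespace Literature.MathematicalPhysics.QuantumFieldTheory.BalabanImbrieJaffe1984to88.BIJ88OpCloseDkLocGradTorus

open Balaban1983to89 hiding Site Plaq
open Balaban1983to89.LatticeFieldCalculus
open BIJ88Ineq217Ineq722Torus (ofLp_HkE_single exists_bound_of_ineq722 torusKernelData_gradH_nonneg)
open BIJ85Eq721MinimizerKernel (torusKernelData_gradH)
open BIJ85AxialPropagator411 (toE)
open BIJ85Prop521Torus BIJ85Prop522Torus BIJ85Sigma422Eta
open BIJ85Sect7Statements BIJ85Ineq722Torus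
open BIJ85Ineq722DeltaA (deltaAData ineq722_deltaA_of_prop12Printed)
open BIJ85Ineq722ProofPart2 (settingOf)
open BIJ88ClocFactorsTorus (Cmat distB distB_apply)
open BIJ88ClocEstimatesTorus (Cloc cloc_estimates)
open BIJ88Cutoffs21 (cutoff cutoffProfile cutoffProfile_eq_one cutoff_nonneg cutoff_le_one)
open BIJ88Sect2Statements (applyK supNorm suppDist)
open BIJ88Close235Proof (supNorm_nonneg)
open BIJ85Sect72AllTori (abs_H_zero_le)
open BIJ85Prop12PerTower (prop12Printed_levStd_deltaA)
open BIJ85Prop12AllTori (prop12Printed_allTori)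
open BIJ88Decay223CkAllTori (exists_HB_allTori_of_prop12Printed)
open BIJ88CurlyDkLocTorus BIJ88CurlyDkLocDecayTorus BIJ88OpDecay213DkLocTorus
open BIJ88CurlyDkLocGradTerm (abs_hlKer_shift_sub_le abs_cutoff_shift_sub_le abs_distEU_shift_sub_le exists_cutoffProfile_lipschitz)
open BIJ88OpDecay213DkLocGradTorus (weighted_rowsum_triple_le₂ applyK_shift_sub)
open BIJ88CurlyDkLocCloseTorus (dk_sub_dkLoc_eq_sum abs_hKer_sub_hlKer_le abs_cKer_sub_clKer_ambient_le cSide_of_cloc_estimates)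
-- inside this namespace the bare `Site`/`Plaq` are the `ℤ^d` carriers of the QFT root; the torus ones are renamed:
open Balaban1983to89 renaming Site → TSite, Plaq → TPlaq

noncomputable section

variable {P : Params}

/-! ## §1  The differenced first factors at scale `j` -/

/-- `0 < L^n`. [folklore] -/
private theorem cast_pow_L_pos' (n : ℕ) : (0 : ℝ) < (P.L : ℝ) ^ n := pow_pos P.cast_L_pos n

/-- `L^k = L^j·L^{k−j}` for `j ≤ k`. [folklore] -/
private theorem pow_eq_pow_mul_pow' {j k : ℕ} (hjk : j ≤ k) : (P.L : ℝ) ^ k = (P.L : ℝ) ^ j * (P.L : ℝ) ^ (k - j) := by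
  rw [← pow_add, Nat.add_sub_cancel' hjk]

/-- `c|D| = |cD|` for `c > 0`. [folklore] -/
private theorem mul_abs_of_pos {c D : ℝ} (hc : 0 < c) : c * |D| = |c * D| := by rw [abs_mul, abs_of_pos hc]

/-- the differenced telescoping `(h₊ch′ − h_{l,+}c_lh′_l) − (hch′ − h_lc_lh′_l) = ((h₊ − h_{l,+}) − (h − h_l))ch′ + (h_{l,+} − h_l)(c − c_l)h′ +
(h_{l,+} − h_l)c_l(h′ − h′_l)`. [folklore] -/
private theorem telescope_grad (hp hlp h hl c cl h' hl' : ℝ) :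
    (hp * c * h' - hlp * cl * hl') - (h * c * h' - hl * cl * hl') =
      ((hp - hlp) - (h - hl)) * c * h' + (hlp - hl) * (c - cl) * h' + (hlp - hl) * cl * (h' - hl') := by ring

/-- **the gradient member of (I.7.2.2) for r18's kernel `hKer`** (`j ≤ m + K`, weights `w > 0`, `c ≠ 0`): `|H_j(⟨x+e_λ,μ⟩; b₁) − H_j(⟨x,μ⟩; b₁)| ≤
L^{−j}·Me^{−δ dist(x,b₁)}` (p08 g7's dictionary `ofLp_HkE_single` + the `λ`-component of the sup norm). [cite: BalabanImbrieJaffe1985, (7.2.2) p.325] -/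
theorem abs_hKer_shift_sub_le {j : ℕ} (hj : j ≤ P.m + P.K) {w c : ℝ} (hw : 0 < w) (hc : c ≠ 0) {a : ℝ} (ha : 0 < a) {δ M : ℝ}
    (hB : ∀ (μ ν : Fin P.d) (x : TSite P 0) (y : TSite P j),
      ‖fun lam : Fin P.d => (P.L : ℝ) ^ j *
          ((torusRep P j (deltaAData hj a)).H (x.shift lam, μ) (y, ν) - (torusRep P j (deltaAData hj a)).H (x, μ) (y, ν))‖ ≤
        M * Real.exp (-(δ * distEU P j x y)))
    (x : TSite P 0) (μ lam : Fin P.d) (b₁ : PBond P j) :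
    |hKer (P := P) w c j ⟨x.shift lam, μ⟩ b₁ - hKer (P := P) w c j ⟨x, μ⟩ b₁| ≤
      ((P.L : ℝ) ^ j)⁻¹ * M * Real.exp (-(δ * distEU P j x b₁.src)) := by
  have hLj : 0 < (P.L : ℝ) ^ j := cast_pow_L_pos' j
  have hent : ∀ (z : TSite P 0) (κ : Fin P.d), hKer (P := P) w c j ⟨z, κ⟩ b₁ =
      (torusRep P j (deltaAData hj a)).H (z, κ) (b₁.src, b₁.dir) := fun z κ => ofLp_HkE_single hj hc hw ha b₁ z κ
  rw [hent, hent]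
  have h1 := (norm_le_pi_norm (fun lam' : Fin P.d => (P.L : ℝ) ^ j *
    ((torusRep P j (deltaAData hj a)).H (x.shift lam', μ) (b₁.src, b₁.dir) -
      (torusRep P j (deltaAData hj a)).H (x, μ) (b₁.src, b₁.dir))) lam).trans (hB μ b₁.dir x b₁.src)
  rw [Real.norm_eq_abs, abs_mul, abs_of_pos hLj] at h1
  rw [mul_assoc, le_inv_mul_iff₀ hLj]
  exact h1

/-- **`Δ_λ(H_j − H_{j,loc})` IS SMALL**: with `H_{j,loc} = ζ_jH_j`, `ζ_j = cutoff R₁ R₀ dist`, `R₁ < R₀`, the sup and gradient members of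
(I.7.2.2) for `H_j` (`M, δ ≥ 0`) and a slope constant `C_σ` of the profile: `|(H_j − H_{j,loc})(⟨x+e_λ,μ⟩; b₁) − (H_j − H_{j,loc})(⟨x,μ⟩; b₁)| ≤
L^{−j}M(1 + C_σ/(R₀ − R₁))e^{δ/2}e^{−(δ/2)R₁}·e^{−(δ/2)dist(x,b₁)}` — the difference `(1 − ζ_j)H_j` and its `η`-difference VANISH when both points are
within `R₁` of `b₁`, and otherwise `dist(x,b₁) ≥ R₁ − 1` (one `η`-step moves the distance by `L^{−j} ≤ 1`); the printed (2.7) mechanism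
*"|H_{k,loc} − H_k| ≦ e^{−cr(e_k)}e^{−c dist}"* for the derivative. [cite: BalabanImbrieJaffe1988, (2.7) p.260] -/
theorem abs_grad_hKer_sub_hlKer_le {j : ℕ} (hj : j ≤ P.m + P.K) {w c : ℝ} (hw : 0 < w) (hc : c ≠ 0) {a : ℝ} (ha : 0 < a) {δ M : ℝ}
    (hδ : 0 ≤ δ)
    (hH : ∀ (μ ν : Fin P.d) (x : TSite P 0) (y : TSite P j),
      |(torusRep P j (deltaAData hj a)).H (x, μ) (y, ν)| ≤ M * Real.exp (-(δ * distEU P j x y)))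
    (hB : ∀ (μ ν : Fin P.d) (x : TSite P 0) (y : TSite P j),
      ‖fun lam : Fin P.d => (P.L : ℝ) ^ j *
          ((torusRep P j (deltaAData hj a)).H (x.shift lam, μ) (y, ν) - (torusRep P j (deltaAData hj a)).H (x, μ) (y, ν))‖ ≤
        M * Real.exp (-(δ * distEU P j x y)))
    {C R₁ R₀ : ℝ} (hC0 : 0 ≤ C) (hR : R₁ < R₀)
    (hCζ : ∀ t s : ℝ, |cutoffProfile R₁ R₀ t - cutoffProfile R₁ R₀ s| ≤ C / (R₀ - R₁) * |t - s|)
    (x : TSite P 0) (μ lam : Fin P.d) (b₁ : PBond P j) :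
    |(hKer (P := P) w c j ⟨x.shift lam, μ⟩ b₁ - hlKer (P := P) w c R₁ R₀ j ⟨x.shift lam, μ⟩ b₁) -
        (hKer (P := P) w c j ⟨x, μ⟩ b₁ - hlKer (P := P) w c R₁ R₀ j ⟨x, μ⟩ b₁)| ≤
      (((P.L : ℝ) ^ j)⁻¹ * (M * (1 + C / (R₀ - R₁)) * Real.exp (δ / 2) * Real.exp (-(δ / 2 * R₁)))) *
        Real.exp (-(δ / 2 * distEU P j x b₁.src)) := by
  have hLj : 0 < (P.L : ℝ) ^ j := cast_pow_L_pos' j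
  have hM : 0 ≤ M := by
    have h := hH ⟨0, P.hd⟩ ⟨0, P.hd⟩ default default
    exact (mul_nonneg_iff_of_pos_right (Real.exp_pos _)).1 ((abs_nonneg _).trans h)
  have hw0 : 0 < R₀ - R₁ := sub_pos.2 hR
  have hent : ∀ (z : TSite P 0) (κ : Fin P.d), hKer (P := P) w c j ⟨z, κ⟩ b₁ =
      (torusRep P j (deltaAData hj a)).H (z, κ) (b₁.src, b₁.dir) := fun z κ => ofLp_HkE_single hj hc hw ha b₁ z κ
  by_cases hnear : hdist (P := P) j ⟨x.shift lam, μ⟩ b₁ ≤ R₁ ∧ hdist (P := P) j ⟨x, μ⟩ b₁ ≤ R₁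
  · -- both cutoffs are `1`: the differenced `(1 − ζ)H` vanishes
    have hζ1 : cutoff R₁ R₀ (hdist (P := P) j) ⟨x.shift lam, μ⟩ b₁ = 1 := cutoffProfile_eq_one hR hnear.1
    have hζ2 : cutoff R₁ R₀ (hdist (P := P) j) ⟨x, μ⟩ b₁ = 1 := cutoffProfile_eq_one hR hnear.2
    rw [hlKer_apply, hlKer_apply, hζ1, hζ2, one_mul, one_mul, sub_self, sub_self, sub_self, abs_zero]
    positivity
  · -- otherwise `dist(x,b₁) ≥ R₁ − 1`
    have hfar : R₁ - 1 ≤ distEU P j x b₁.src := by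
      have hstep := abs_distEU_shift_sub_le (P := P) j x lam b₁.src
      rw [abs_le] at hstep
      by_contra hlt
      have hlt' : distEU P j x b₁.src < R₁ - 1 := lt_of_not_ge hlt
      refine hnear ⟨?_, ?_⟩
      · show distEU P j (x.shift lam) b₁.src ≤ R₁
        have hLinv : ((P.L : ℝ) ^ j)⁻¹ ≤ 1 := inv_le_one_of_one_le₀ (one_le_pow₀ (by exact_mod_cast P.L_pos))
        linarith [hstep.2]
      · show distEU P j x b₁.src ≤ R₁
        linarith
    -- the two pieces of the product rule
    have hDx : |hKer (P := P) w c j ⟨x.shift lam, μ⟩ b₁ - hKer (P := P) w c j ⟨x, μ⟩ b₁| ≤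
        ((P.L : ℝ) ^ j)⁻¹ * M * Real.exp (-(δ * distEU P j x b₁.src)) := abs_hKer_shift_sub_le hj hw hc ha hB x μ lam b₁
    have hHx : |hKer (P := P) w c j ⟨x, μ⟩ b₁| ≤ M * Real.exp (-(δ * distEU P j x b₁.src)) := by
      rw [hent]; exact hH _ _ _ _
    have hζD := abs_cutoff_shift_sub_le (P := P) hC0 hR hCζ j x μ lam b₁
    have hζ1 : |1 - cutoff R₁ R₀ (hdist (P := P) j) ⟨x.shift lam, μ⟩ b₁| ≤ 1 := by
      have h0 := cutoff_nonneg R₁ R₀ (hdist (P := P) j) ⟨x.shift lam, μ⟩ b₁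
      have h1 := cutoff_le_one R₁ R₀ (hdist (P := P) j) ⟨x.shift lam, μ⟩ b₁
      rw [abs_le]; constructor <;> linarith
    rw [hlKer_apply, hlKer_apply]
    have e : hKer w c j ⟨x.shift lam, μ⟩ b₁ - cutoff R₁ R₀ (hdist (P := P) j) ⟨x.shift lam, μ⟩ b₁ * hKer w c j ⟨x.shift lam, μ⟩ b₁ -
        (hKer w c j ⟨x, μ⟩ b₁ - cutoff R₁ R₀ (hdist (P := P) j) ⟨x, μ⟩ b₁ * hKer w c j ⟨x, μ⟩ b₁) =
        (1 - cutoff R₁ R₀ (hdist (P := P) j) ⟨x.shift lam, μ⟩ b₁) * (hKer w c j ⟨x.shift lam, μ⟩ b₁ - hKer w c j ⟨x, μ⟩ b₁) -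
          (cutoff R₁ R₀ (hdist (P := P) j) ⟨x.shift lam, μ⟩ b₁ - cutoff R₁ R₀ (hdist (P := P) j) ⟨x, μ⟩ b₁) * hKer w c j ⟨x, μ⟩ b₁ := by
      ring
    rw [e]
    refine (abs_sub _ _).trans ?_
    rw [abs_mul, abs_mul]
    -- the exponential bookkeeping: `e^{−δ dist} ≤ e^{δ/2}e^{−(δ/2)R₁}e^{−(δ/2)dist}`
    have hexp : Real.exp (-(δ * distEU P j x b₁.src)) ≤
        Real.exp (δ / 2) * Real.exp (-(δ / 2 * R₁)) * Real.exp (-(δ / 2 * distEU P j x b₁.src)) := by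
      rw [← Real.exp_add, ← Real.exp_add]
      exact Real.exp_le_exp.2 (by nlinarith [mul_le_mul_of_nonneg_left hfar hδ])
    calc |1 - cutoff R₁ R₀ (hdist (P := P) j) ⟨x.shift lam, μ⟩ b₁| * |hKer w c j ⟨x.shift lam, μ⟩ b₁ - hKer w c j ⟨x, μ⟩ b₁| +
          |cutoff R₁ R₀ (hdist (P := P) j) ⟨x.shift lam, μ⟩ b₁ - cutoff R₁ R₀ (hdist (P := P) j) ⟨x, μ⟩ b₁| * |hKer w c j ⟨x, μ⟩ b₁|
        ≤ 1 * (((P.L : ℝ) ^ j)⁻¹ * M * Real.exp (-(δ * distEU P j x b₁.src))) +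
            C / (R₀ - R₁) * ((P.L : ℝ) ^ j)⁻¹ * (M * Real.exp (-(δ * distEU P j x b₁.src))) :=
          add_le_add (mul_le_mul hζ1 hDx (abs_nonneg _) zero_le_one) (mul_le_mul hζD hHx (abs_nonneg _) (by positivity))
      _ = ((P.L : ℝ) ^ j)⁻¹ * (M * (1 + C / (R₀ - R₁))) * Real.exp (-(δ * distEU P j x b₁.src)) := by ring
      _ ≤ ((P.L : ℝ) ^ j)⁻¹ * (M * (1 + C / (R₀ - R₁))) *
            (Real.exp (δ / 2) * Real.exp (-(δ / 2 * R₁)) * Real.exp (-(δ / 2 * distEU P j x b₁.src))) :=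
          mul_le_mul_of_nonneg_left hexp (by positivity)
      _ = _ := by ring

/-! ## §2  Weighted row sums of the differenced difference term, scale by scale -/

/-- `Σ_{j<k} L^{−(k−j)} ≤ 1` (`L ≥ 2`). [folklore] -/
private theorem sum_inv_pow_le_one (k : ℕ) : ∑ j ∈ Finset.range k, ((P.L : ℝ) ^ (k - j))⁻¹ ≤ 1 := by
  have hL : (2 : ℝ) ≤ P.L := by exact_mod_cast P.hL.2
  induction k with
  | zero => simp
  | succ k ih =>
    have e : ∑ j ∈ Finset.range (k + 1), ((P.L : ℝ) ^ (k + 1 - j))⁻¹ =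
        (P.L : ℝ)⁻¹ * (∑ j ∈ Finset.range k, ((P.L : ℝ) ^ (k - j))⁻¹ + 1) := by
      rw [Finset.sum_range_succ, show k + 1 - k = 1 by omega, pow_one, mul_add, mul_one, Finset.mul_sum]
      refine congrArg (· + _) (Finset.sum_congr rfl fun j hj => ?_)
      rw [show k + 1 - j = (k - j) + 1 by have := Finset.mem_range.1 hj; omega, pow_succ, mul_inv, mul_comm]
    rw [e]
    calc (P.L : ℝ)⁻¹ * (∑ j ∈ Finset.range k, ((P.L : ℝ) ^ (k - j))⁻¹ + 1) ≤ 2⁻¹ * (1 + 1) :=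
          mul_le_mul ((inv_le_inv₀ (by linarith) two_pos).2 hL) (by linarith) (by positivity) (by norm_num)
      _ = 1 := by norm_num

/-- **THE SCALE-`j` DIFFERENCE TERM, DIFFERENCED IN THE OUTPUT POINT, `η^d`-WEIGHTED ROW SUM** (`j ≤ k`, `j ≤ m + K`, every `d ≥ 2`, radius
`r > 0`): with the sup and gradient members of (I.7.2.2) for `H_j`, a slope constant `C_σ`, and the three C-side bounds,
`Σ_{b″} η_k^dL^k|[H_jC^{(j)}H_j − H_{j,loc}C^{(j)}_{loc}H_{j,loc}](⟨x+e_λ,μ⟩,b″) − [same](⟨x,μ⟩,b″)|·e^{a·dist_k(b″,⟨x,μ⟩)} ≤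
(1 + 16C_σ/r)((e^{δ/2} + 1)e^{−(δ/2)(r/16)} + e^{−(δ_C/4)r})·M²M_C·d³e^{a/2}K(a)³·(L^{k−j})^{−1}`, `a = min(δ/2,δ_C)/2`. [cite: BalabanImbrieJaffe1988, (2.13) p.261] -/
theorem weighted_rowsum_gradDiffTerm_le (hd : 2 ≤ P.d) {k j : ℕ} (hj : j ≤ P.m + P.K) (hjk : j ≤ k) {a : ℝ} (ha : 0 < a)
    {δ M δC MC : ℝ} (hδ : 0 < δ) (hδC : 0 < δC) (hM : 0 ≤ M) (hMC : 0 ≤ MC)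
    (hH : ∀ (μ ν : Fin P.d) (x : TSite P 0) (y : TSite P j),
      |(torusRep P j (deltaAData hj a)).H (x, μ) (y, ν)| ≤ M * Real.exp (-(δ * distEU P j x y)))
    (hB : ∀ (μ ν : Fin P.d) (x : TSite P 0) (y : TSite P j),
      ‖fun lam : Fin P.d => (P.L : ℝ) ^ j *
          ((torusRep P j (deltaAData hj a)).H (x.shift lam, μ) (y, ν) - (torusRep P j (deltaAData hj a)).H (x, μ) (y, ν))‖ ≤
        M * Real.exp (-(δ * distEU P j x y)))
    {C : ℝ} (hC0 : 0 ≤ C) (hCζ : ∀ (R₁ R₀ : ℝ), R₁ < R₀ → ∀ t s : ℝ,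
      |cutoffProfile R₁ R₀ t - cutoffProfile R₁ R₀ s| ≤ C / (R₀ - R₁) * |t - s|)
    {r : ℝ} (hr : 0 < r)
    (hCm : ∀ b₁ b₂ : PBond P j, |Cmat P j b₁ b₂| ≤ MC * Real.exp (-(δC * (supDist b₁.src b₂.src : ℝ))))
    (hCl : ∀ b₁ b₂ : PBond P j, |Cloc P j (r / 4) b₁ b₂| ≤ MC * Real.exp (-(δC * (supDist b₁.src b₂.src : ℝ))))
    (hCd : ∀ b₁ b₂ : PBond P j, |Cloc P j (r / 4) b₁ b₂ - Cmat P j b₁ b₂| ≤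
      MC * Real.exp (-(δC / 4 * r)) * Real.exp (-(δC * (supDist b₁.src b₂.src : ℝ))))
    (x : TSite P 0) (μ lam : Fin P.d) :
    ∑ b'' : PBond P 0, (P.eta k) ^ P.d * (P.L : ℝ) ^ k *
        |(∑ b₁ : PBond P j, ∑ b₂ : PBond P j,
            (hKer (P := P) ((P.eta k) ^ P.d) ((P.L : ℝ) ^ k) j ⟨x.shift lam, μ⟩ b₁ *
                cKer (P := P) ((P.eta k) ^ P.d) ((P.L : ℝ) ^ k) j b₁ b₂ * hKer (P := P) ((P.eta k) ^ P.d) ((P.L : ℝ) ^ k) j b'' b₂ -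
              hlKer (P := P) ((P.eta k) ^ P.d) ((P.L : ℝ) ^ k) (r / 16) (r / 8) j ⟨x.shift lam, μ⟩ b₁ *
                  clKer (P := P) ((P.eta k) ^ P.d) ((P.L : ℝ) ^ k) (r / 4) j b₁ b₂ *
                hlKer (P := P) ((P.eta k) ^ P.d) ((P.L : ℝ) ^ k) (r / 16) (r / 8) j b'' b₂)) -
          (∑ b₁ : PBond P j, ∑ b₂ : PBond P j,
            (hKer (P := P) ((P.eta k) ^ P.d) ((P.L : ℝ) ^ k) j ⟨x, μ⟩ b₁ *
                cKer (P := P) ((P.eta k) ^ P.d) ((P.L : ℝ) ^ k) j b₁ b₂ * hKer (P := P) ((P.eta k) ^ P.d) ((P.L : ℝ) ^ k) j b'' b₂ -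
              hlKer (P := P) ((P.eta k) ^ P.d) ((P.L : ℝ) ^ k) (r / 16) (r / 8) j ⟨x, μ⟩ b₁ *
                  clKer (P := P) ((P.eta k) ^ P.d) ((P.L : ℝ) ^ k) (r / 4) j b₁ b₂ *
                hlKer (P := P) ((P.eta k) ^ P.d) ((P.L : ℝ) ^ k) (r / 16) (r / 8) j b'' b₂))| *
        Real.exp (min (δ / 2) δC / 2 * kdist (P := P) k b'' ⟨x, μ⟩) ≤
      (1 + 16 * C / r) * ((Real.exp (δ / 2) + 1) * Real.exp (-(δ / 2 * (r / 16))) + Real.exp (-(δC / 4 * r))) *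
        (M ^ 2 * MC * (P.d : ℝ) ^ 3 * (Real.exp (min (δ / 2) δC / 2 / 2) * ((2 * (1 + P.d / (min (δ / 2) δC / 2))) ^ P.d) ^ 3)) *
        ((P.L : ℝ) ^ (k - j))⁻¹ := by
  have hδ2 : 0 < δ / 2 := half_pos hδ
  have hR : r / 16 < r / 8 := by linarith
  have hRw : r / 8 - r / 16 = r / 16 := by ring
  have e16 : C / (r / 16) = 16 * C / r := by field_simp
  have hw : 0 < (P.eta k) ^ P.d := pow_pos (eta_pos P k) _
  have hc : (P.L : ℝ) ^ k ≠ 0 := (cast_pow_L_pos' k).ne'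
  have hLk : 0 < (P.L : ℝ) ^ k := cast_pow_L_pos' k
  have hLj : 0 < (P.L : ℝ) ^ j := cast_pow_L_pos' j
  set ℓ : ℝ := (P.L : ℝ) ^ (k - j) with hℓ
  have hℓ0 : 0 < ℓ := cast_pow_L_pos' _
  have hℓq : 0 < ℓ ^ (P.d - 2) := pow_pos hℓ0 _
  have hfac : 0 ≤ 1 + 16 * C / r := by positivity
  -- the H-side bounds at rate `δ/2`
  have weaken : ∀ (x : TSite P 0) (y : TSite P j) (A : ℝ), 0 ≤ A →
      A * Real.exp (-(δ * distEU P j x y)) ≤ A * Real.exp (-(δ / 2 * distEU P j x y)) := by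
    intro x y A hA
    refine mul_le_mul_of_nonneg_left (Real.exp_le_exp.2 ?_) hA
    have h0 : 0 ≤ distEU P j x y := div_nonneg (Nat.cast_nonneg _) (cast_pow_L_pos' j).le
    nlinarith
  have hh : ∀ (b₀ : PBond P 0) (b₁ : PBond P j),
      |hKer (P := P) ((P.eta k) ^ P.d) ((P.L : ℝ) ^ k) j b₀ b₁| ≤ M * Real.exp (-(δ / 2 * distEU P j b₀.src b₁.src)) := by
    intro b₀ b₁
    have e : hKer (P := P) ((P.eta k) ^ P.d) ((P.L : ℝ) ^ k) j b₀ b₁ =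
        (torusRep P j (deltaAData hj a)).H (b₀.src, b₀.dir) (b₁.src, b₁.dir) := ofLp_HkE_single hj hc hw ha b₁ b₀.src b₀.dir
    rw [e]
    exact (hH _ _ _ _).trans (weaken _ _ M hM)
  have hhd : ∀ (b₀ : PBond P 0) (b₁ : PBond P j),
      |(fun (b₀ : PBond P 0) (b₁ : PBond P j) => hKer (P := P) ((P.eta k) ^ P.d) ((P.L : ℝ) ^ k) j b₀ b₁ -
          hlKer (P := P) ((P.eta k) ^ P.d) ((P.L : ℝ) ^ k) (r / 16) (r / 8) j b₀ b₁) b₀ b₁| ≤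
        M * Real.exp (-(δ / 2 * (r / 16))) * Real.exp (-(δ / 2 * distEU P j b₀.src b₁.src)) :=
    fun b₀ b₁ => abs_hKer_sub_hlKer_le hj hw hc ha hδ.le hH hR b₀ b₁
  -- the differenced first factors
  have hgd : ∀ (b₀ : PBond P 0) (b₁ : PBond P j),
      |(fun (b₀ : PBond P 0) (b₁ : PBond P j) =>
          (hKer (P := P) ((P.eta k) ^ P.d) ((P.L : ℝ) ^ k) j ⟨b₀.src.shift lam, b₀.dir⟩ b₁ -
              hlKer (P := P) ((P.eta k) ^ P.d) ((P.L : ℝ) ^ k) (r / 16) (r / 8) j ⟨b₀.src.shift lam, b₀.dir⟩ b₁) -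
            (hKer (P := P) ((P.eta k) ^ P.d) ((P.L : ℝ) ^ k) j b₀ b₁ -
              hlKer (P := P) ((P.eta k) ^ P.d) ((P.L : ℝ) ^ k) (r / 16) (r / 8) j b₀ b₁)) b₀ b₁| ≤
        (((P.L : ℝ) ^ j)⁻¹ * (M * (1 + 16 * C / r) * Real.exp (δ / 2) * Real.exp (-(δ / 2 * (r / 16))))) *
          Real.exp (-(δ / 2 * distEU P j b₀.src b₁.src)) := by
    intro b₀ b₁
    have h := abs_grad_hKer_sub_hlKer_le hj hw hc ha hδ.le hH hB hC0 hR (hCζ _ _ hR) b₀.src b₀.dir lam b₁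
    rw [hRw, e16] at h
    exact h
  have hgl : ∀ (b₀ : PBond P 0) (b₁ : PBond P j),
      |(fun (b₀ : PBond P 0) (b₁ : PBond P j) =>
          hlKer (P := P) ((P.eta k) ^ P.d) ((P.L : ℝ) ^ k) (r / 16) (r / 8) j ⟨b₀.src.shift lam, b₀.dir⟩ b₁ -
            hlKer (P := P) ((P.eta k) ^ P.d) ((P.L : ℝ) ^ k) (r / 16) (r / 8) j b₀ b₁) b₀ b₁| ≤
        (((P.L : ℝ) ^ j)⁻¹ * (M * (1 + 16 * C / r))) * Real.exp (-(δ / 2 * distEU P j b₀.src b₁.src)) := by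
    intro b₀ b₁
    have h := abs_hlKer_shift_sub_le hj hw hc ha hH hB hC0 hR (hCζ _ _ hR) b₀.src b₀.dir lam b₁
    rw [hRw, e16] at h
    exact h.trans (weaken _ _ _ (by positivity))
  -- the C-side bounds at the ambient weights
  have hc1 : ∀ b₁ b₂ : PBond P j, |cKer (P := P) ((P.eta k) ^ P.d) ((P.L : ℝ) ^ k) j b₁ b₂| ≤
      MC * ℓ ^ (P.d - 2) * Real.exp (-(δC * (supDist b₁.src b₂.src : ℝ))) := by
    intro b₁ b₂
    rw [cKer_ambient_eq hd hjk, abs_mul, abs_of_pos hℓq]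
    calc ℓ ^ (P.d - 2) * |Cmat P j b₁ b₂| ≤ ℓ ^ (P.d - 2) * (MC * Real.exp (-(δC * (supDist b₁.src b₂.src : ℝ)))) :=
        mul_le_mul_of_nonneg_left (hCm b₁ b₂) hℓq.le
      _ = _ := by ring
  have hc2 : ∀ b₁ b₂ : PBond P j, |clKer (P := P) ((P.eta k) ^ P.d) ((P.L : ℝ) ^ k) (r / 4) j b₁ b₂| ≤
      MC * ℓ ^ (P.d - 2) * Real.exp (-(δC * (supDist b₁.src b₂.src : ℝ))) := fun b₁ b₂ => abs_clKer_ambient_le hd hjk hCl b₁ b₂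
  have hc3 : ∀ b₁ b₂ : PBond P j,
      |(fun b₁ b₂ : PBond P j => cKer (P := P) ((P.eta k) ^ P.d) ((P.L : ℝ) ^ k) j b₁ b₂ -
          clKer (P := P) ((P.eta k) ^ P.d) ((P.L : ℝ) ^ k) (r / 4) j b₁ b₂) b₁ b₂| ≤
        (ℓ ^ (P.d - 2) * MC * Real.exp (-(δC / 4 * r))) * Real.exp (-(δC * (supDist b₁.src b₂.src : ℝ))) := by
    intro b₁ b₂
    have h := abs_cKer_sub_clKer_ambient_le hd hjk (δC := δC) (ε := MC * Real.exp (-(δC / 4 * r))) (R := r / 4)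
      (fun b₁ b₂ => (hCd b₁ b₂).trans (le_of_eq (by ring))) b₁ b₂
    refine h.trans (le_of_eq ?_)
    rw [hℓ]; ring
  -- the three products with differenced first factors, weighted row sums
  have hA1 : 0 ≤ ((P.L : ℝ) ^ j)⁻¹ * (M * (1 + 16 * C / r) * Real.exp (δ / 2) * Real.exp (-(δ / 2 * (r / 16)))) := by positivity
  have hA2 : 0 ≤ ((P.L : ℝ) ^ j)⁻¹ * (M * (1 + 16 * C / r)) := by positivity
  have hM' : 0 ≤ M * Real.exp (-(δ / 2 * (r / 16))) := by positivity
  have hMC1 : 0 ≤ MC * ℓ ^ (P.d - 2) := by positivity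
  have hMC3 : 0 ≤ ℓ ^ (P.d - 2) * MC * Real.exp (-(δC / 4 * r)) := by positivity
  have t1 := weighted_rowsum_triple_le₂ (k := k) hj hjk hδ2 hδC hA1 hM hMC1 hgd hh hc1 ⟨x, μ⟩
  have t2 := weighted_rowsum_triple_le₂ (k := k) hj hjk hδ2 hδC hA2 hM hMC3 hgl hh hc3 ⟨x, μ⟩
  have t3 := weighted_rowsum_triple_le₂ (k := k) hj hjk hδ2 hδC hA2 hM' hMC1 hgl hhd hc2 ⟨x, μ⟩
  -- split the differenced scale term into the three products, pointwise in `b″`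
  have hsplit : ∀ b'' : PBond P 0,
      (∑ b₁ : PBond P j, ∑ b₂ : PBond P j,
          (hKer (P := P) ((P.eta k) ^ P.d) ((P.L : ℝ) ^ k) j ⟨x.shift lam, μ⟩ b₁ *
              cKer (P := P) ((P.eta k) ^ P.d) ((P.L : ℝ) ^ k) j b₁ b₂ * hKer (P := P) ((P.eta k) ^ P.d) ((P.L : ℝ) ^ k) j b'' b₂ -
            hlKer (P := P) ((P.eta k) ^ P.d) ((P.L : ℝ) ^ k) (r / 16) (r / 8) j ⟨x.shift lam, μ⟩ b₁ *
                clKer (P := P) ((P.eta k) ^ P.d) ((P.L : ℝ) ^ k) (r / 4) j b₁ b₂ *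
              hlKer (P := P) ((P.eta k) ^ P.d) ((P.L : ℝ) ^ k) (r / 16) (r / 8) j b'' b₂)) -
        (∑ b₁ : PBond P j, ∑ b₂ : PBond P j,
          (hKer (P := P) ((P.eta k) ^ P.d) ((P.L : ℝ) ^ k) j ⟨x, μ⟩ b₁ *
              cKer (P := P) ((P.eta k) ^ P.d) ((P.L : ℝ) ^ k) j b₁ b₂ * hKer (P := P) ((P.eta k) ^ P.d) ((P.L : ℝ) ^ k) j b'' b₂ -
            hlKer (P := P) ((P.eta k) ^ P.d) ((P.L : ℝ) ^ k) (r / 16) (r / 8) j ⟨x, μ⟩ b₁ *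
                clKer (P := P) ((P.eta k) ^ P.d) ((P.L : ℝ) ^ k) (r / 4) j b₁ b₂ *
              hlKer (P := P) ((P.eta k) ^ P.d) ((P.L : ℝ) ^ k) (r / 16) (r / 8) j b'' b₂)) =
      (∑ b₁ : PBond P j, ∑ b₂ : PBond P j,
        (fun (b₀ : PBond P 0) (b₁ : PBond P j) =>
            (hKer (P := P) ((P.eta k) ^ P.d) ((P.L : ℝ) ^ k) j ⟨b₀.src.shift lam, b₀.dir⟩ b₁ -
                hlKer (P := P) ((P.eta k) ^ P.d) ((P.L : ℝ) ^ k) (r / 16) (r / 8) j ⟨b₀.src.shift lam, b₀.dir⟩ b₁) -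
              (hKer (P := P) ((P.eta k) ^ P.d) ((P.L : ℝ) ^ k) j b₀ b₁ -
                hlKer (P := P) ((P.eta k) ^ P.d) ((P.L : ℝ) ^ k) (r / 16) (r / 8) j b₀ b₁)) ⟨x, μ⟩ b₁ *
          cKer (P := P) ((P.eta k) ^ P.d) ((P.L : ℝ) ^ k) j b₁ b₂ * hKer (P := P) ((P.eta k) ^ P.d) ((P.L : ℝ) ^ k) j b'' b₂) +
      (∑ b₁ : PBond P j, ∑ b₂ : PBond P j,
        (fun (b₀ : PBond P 0) (b₁ : PBond P j) =>
            hlKer (P := P) ((P.eta k) ^ P.d) ((P.L : ℝ) ^ k) (r / 16) (r / 8) j ⟨b₀.src.shift lam, b₀.dir⟩ b₁ -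
              hlKer (P := P) ((P.eta k) ^ P.d) ((P.L : ℝ) ^ k) (r / 16) (r / 8) j b₀ b₁) ⟨x, μ⟩ b₁ *
          (fun b₁ b₂ : PBond P j => cKer (P := P) ((P.eta k) ^ P.d) ((P.L : ℝ) ^ k) j b₁ b₂ -
            clKer (P := P) ((P.eta k) ^ P.d) ((P.L : ℝ) ^ k) (r / 4) j b₁ b₂) b₁ b₂ *
          hKer (P := P) ((P.eta k) ^ P.d) ((P.L : ℝ) ^ k) j b'' b₂) +
      (∑ b₁ : PBond P j, ∑ b₂ : PBond P j,
        (fun (b₀ : PBond P 0) (b₁ : PBond P j) =>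
            hlKer (P := P) ((P.eta k) ^ P.d) ((P.L : ℝ) ^ k) (r / 16) (r / 8) j ⟨b₀.src.shift lam, b₀.dir⟩ b₁ -
              hlKer (P := P) ((P.eta k) ^ P.d) ((P.L : ℝ) ^ k) (r / 16) (r / 8) j b₀ b₁) ⟨x, μ⟩ b₁ *
          clKer (P := P) ((P.eta k) ^ P.d) ((P.L : ℝ) ^ k) (r / 4) j b₁ b₂ *
          (fun (b₀ : PBond P 0) (b₁ : PBond P j) => hKer (P := P) ((P.eta k) ^ P.d) ((P.L : ℝ) ^ k) j b₀ b₁ -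
            hlKer (P := P) ((P.eta k) ^ P.d) ((P.L : ℝ) ^ k) (r / 16) (r / 8) j b₀ b₁) b'' b₂) := by
    intro b''
    rw [← Finset.sum_sub_distrib, ← Finset.sum_add_distrib, ← Finset.sum_add_distrib]
    refine Finset.sum_congr rfl fun b₁ _ => ?_
    rw [← Finset.sum_sub_distrib, ← Finset.sum_add_distrib, ← Finset.sum_add_distrib]
    refine Finset.sum_congr rfl fun b₂ _ => ?_
    exact telescope_grad _ _ _ _ _ _ _ _
  have hscal : (P.eta k) ^ P.d * (P.L : ℝ) ^ k * (((P.L : ℝ) ^ j)⁻¹ * ℓ ^ (P.d - 2) * ((P.L : ℝ) ^ j) ^ P.d) = ℓ⁻¹ := by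
    have hsc := eta_pow_scaling (P := P) hd hjk
    calc (P.eta k) ^ P.d * (P.L : ℝ) ^ k * (((P.L : ℝ) ^ j)⁻¹ * ℓ ^ (P.d - 2) * ((P.L : ℝ) ^ j) ^ P.d)
        = ((P.L : ℝ) ^ k * ((P.L : ℝ) ^ j)⁻¹) * ((P.eta k) ^ P.d * ℓ ^ (P.d - 2) * ((P.L : ℝ) ^ j) ^ P.d) := by ring
      _ = ℓ * (ℓ ^ 2)⁻¹ := by
          rw [hℓ, hsc, pow_eq_pow_mul_pow' (P := P) hjk, mul_assoc, mul_comm ((P.L : ℝ) ^ j), ← mul_assoc,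
            mul_inv_cancel_right₀ hLj.ne']
      _ = ℓ⁻¹ := by rw [sq, mul_inv, ← mul_assoc, mul_inv_cancel₀ hℓ0.ne', one_mul]
  -- pointwise split of the summand, then the three row sums
  calc ∑ b'' : PBond P 0, (P.eta k) ^ P.d * (P.L : ℝ) ^ k * |_| * Real.exp (min (δ / 2) δC / 2 * kdist (P := P) k b'' ⟨x, μ⟩)
      ≤ ∑ b'' : PBond P 0, (P.eta k) ^ P.d * (P.L : ℝ) ^ k * ((|∑ b₁ : PBond P j, ∑ b₂ : PBond P j,
        (fun (b₀ : PBond P 0) (b₁ : PBond P j) =>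
            (hKer (P := P) ((P.eta k) ^ P.d) ((P.L : ℝ) ^ k) j ⟨b₀.src.shift lam, b₀.dir⟩ b₁ -
                hlKer (P := P) ((P.eta k) ^ P.d) ((P.L : ℝ) ^ k) (r / 16) (r / 8) j ⟨b₀.src.shift lam, b₀.dir⟩ b₁) -
              (hKer (P := P) ((P.eta k) ^ P.d) ((P.L : ℝ) ^ k) j b₀ b₁ -
                hlKer (P := P) ((P.eta k) ^ P.d) ((P.L : ℝ) ^ k) (r / 16) (r / 8) j b₀ b₁)) ⟨x, μ⟩ b₁ *
          cKer (P := P) ((P.eta k) ^ P.d) ((P.L : ℝ) ^ k) j b₁ b₂ * hKer (P := P) ((P.eta k) ^ P.d) ((P.L : ℝ) ^ k) j b'' b₂| *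
            Real.exp (min (δ / 2) δC / 2 * kdist (P := P) k b'' ⟨x, μ⟩) +
          |∑ b₁ : PBond P j, ∑ b₂ : PBond P j,
        (fun (b₀ : PBond P 0) (b₁ : PBond P j) =>
            hlKer (P := P) ((P.eta k) ^ P.d) ((P.L : ℝ) ^ k) (r / 16) (r / 8) j ⟨b₀.src.shift lam, b₀.dir⟩ b₁ -
              hlKer (P := P) ((P.eta k) ^ P.d) ((P.L : ℝ) ^ k) (r / 16) (r / 8) j b₀ b₁) ⟨x, μ⟩ b₁ *
          (fun b₁ b₂ : PBond P j => cKer (P := P) ((P.eta k) ^ P.d) ((P.L : ℝ) ^ k) j b₁ b₂ -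
            clKer (P := P) ((P.eta k) ^ P.d) ((P.L : ℝ) ^ k) (r / 4) j b₁ b₂) b₁ b₂ *
          hKer (P := P) ((P.eta k) ^ P.d) ((P.L : ℝ) ^ k) j b'' b₂| *
            Real.exp (min (δ / 2) δC / 2 * kdist (P := P) k b'' ⟨x, μ⟩)) +
          |∑ b₁ : PBond P j, ∑ b₂ : PBond P j,
        (fun (b₀ : PBond P 0) (b₁ : PBond P j) =>
            hlKer (P := P) ((P.eta k) ^ P.d) ((P.L : ℝ) ^ k) (r / 16) (r / 8) j ⟨b₀.src.shift lam, b₀.dir⟩ b₁ -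
              hlKer (P := P) ((P.eta k) ^ P.d) ((P.L : ℝ) ^ k) (r / 16) (r / 8) j b₀ b₁) ⟨x, μ⟩ b₁ *
          clKer (P := P) ((P.eta k) ^ P.d) ((P.L : ℝ) ^ k) (r / 4) j b₁ b₂ *
          (fun (b₀ : PBond P 0) (b₁ : PBond P j) => hKer (P := P) ((P.eta k) ^ P.d) ((P.L : ℝ) ^ k) j b₀ b₁ -
            hlKer (P := P) ((P.eta k) ^ P.d) ((P.L : ℝ) ^ k) (r / 16) (r / 8) j b₀ b₁) b'' b₂| *
            Real.exp (min (δ / 2) δC / 2 * kdist (P := P) k b'' ⟨x, μ⟩)) := by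
        refine Finset.sum_le_sum fun b'' _ => ?_
        rw [hsplit b'', mul_assoc ((P.eta k) ^ P.d * (P.L : ℝ) ^ k)]
        refine mul_le_mul_of_nonneg_left ?_ (mul_pos hw hLk).le
        have hE := (Real.exp_pos (min (δ / 2) δC / 2 * kdist (P := P) k b'' ⟨x, μ⟩)).le
        nlinarith [abs_add_three
          (∑ b₁ : PBond P j, ∑ b₂ : PBond P j,
        (fun (b₀ : PBond P 0) (b₁ : PBond P j) =>
            (hKer (P := P) ((P.eta k) ^ P.d) ((P.L : ℝ) ^ k) j ⟨b₀.src.shift lam, b₀.dir⟩ b₁ -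
                hlKer (P := P) ((P.eta k) ^ P.d) ((P.L : ℝ) ^ k) (r / 16) (r / 8) j ⟨b₀.src.shift lam, b₀.dir⟩ b₁) -
              (hKer (P := P) ((P.eta k) ^ P.d) ((P.L : ℝ) ^ k) j b₀ b₁ -
                hlKer (P := P) ((P.eta k) ^ P.d) ((P.L : ℝ) ^ k) (r / 16) (r / 8) j b₀ b₁)) ⟨x, μ⟩ b₁ *
          cKer (P := P) ((P.eta k) ^ P.d) ((P.L : ℝ) ^ k) j b₁ b₂ * hKer (P := P) ((P.eta k) ^ P.d) ((P.L : ℝ) ^ k) j b'' b₂)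
          (∑ b₁ : PBond P j, ∑ b₂ : PBond P j,
        (fun (b₀ : PBond P 0) (b₁ : PBond P j) =>
            hlKer (P := P) ((P.eta k) ^ P.d) ((P.L : ℝ) ^ k) (r / 16) (r / 8) j ⟨b₀.src.shift lam, b₀.dir⟩ b₁ -
              hlKer (P := P) ((P.eta k) ^ P.d) ((P.L : ℝ) ^ k) (r / 16) (r / 8) j b₀ b₁) ⟨x, μ⟩ b₁ *
          (fun b₁ b₂ : PBond P j => cKer (P := P) ((P.eta k) ^ P.d) ((P.L : ℝ) ^ k) j b₁ b₂ -
            clKer (P := P) ((P.eta k) ^ P.d) ((P.L : ℝ) ^ k) (r / 4) j b₁ b₂) b₁ b₂ *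
          hKer (P := P) ((P.eta k) ^ P.d) ((P.L : ℝ) ^ k) j b'' b₂)
          (∑ b₁ : PBond P j, ∑ b₂ : PBond P j,
        (fun (b₀ : PBond P 0) (b₁ : PBond P j) =>
            hlKer (P := P) ((P.eta k) ^ P.d) ((P.L : ℝ) ^ k) (r / 16) (r / 8) j ⟨b₀.src.shift lam, b₀.dir⟩ b₁ -
              hlKer (P := P) ((P.eta k) ^ P.d) ((P.L : ℝ) ^ k) (r / 16) (r / 8) j b₀ b₁) ⟨x, μ⟩ b₁ *
          clKer (P := P) ((P.eta k) ^ P.d) ((P.L : ℝ) ^ k) (r / 4) j b₁ b₂ *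
          (fun (b₀ : PBond P 0) (b₁ : PBond P j) => hKer (P := P) ((P.eta k) ^ P.d) ((P.L : ℝ) ^ k) j b₀ b₁ -
            hlKer (P := P) ((P.eta k) ^ P.d) ((P.L : ℝ) ^ k) (r / 16) (r / 8) j b₀ b₁) b'' b₂)]
    _ = (P.eta k) ^ P.d * (P.L : ℝ) ^ k * ((∑ b'' : PBond P 0, |∑ b₁ : PBond P j, ∑ b₂ : PBond P j,
        (fun (b₀ : PBond P 0) (b₁ : PBond P j) =>
            (hKer (P := P) ((P.eta k) ^ P.d) ((P.L : ℝ) ^ k) j ⟨b₀.src.shift lam, b₀.dir⟩ b₁ -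
                hlKer (P := P) ((P.eta k) ^ P.d) ((P.L : ℝ) ^ k) (r / 16) (r / 8) j ⟨b₀.src.shift lam, b₀.dir⟩ b₁) -
              (hKer (P := P) ((P.eta k) ^ P.d) ((P.L : ℝ) ^ k) j b₀ b₁ -
                hlKer (P := P) ((P.eta k) ^ P.d) ((P.L : ℝ) ^ k) (r / 16) (r / 8) j b₀ b₁)) ⟨x, μ⟩ b₁ *
          cKer (P := P) ((P.eta k) ^ P.d) ((P.L : ℝ) ^ k) j b₁ b₂ * hKer (P := P) ((P.eta k) ^ P.d) ((P.L : ℝ) ^ k) j b'' b₂| *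
            Real.exp (min (δ / 2) δC / 2 * kdist (P := P) k b'' ⟨x, μ⟩) +
          ∑ b'' : PBond P 0, |∑ b₁ : PBond P j, ∑ b₂ : PBond P j,
        (fun (b₀ : PBond P 0) (b₁ : PBond P j) =>
            hlKer (P := P) ((P.eta k) ^ P.d) ((P.L : ℝ) ^ k) (r / 16) (r / 8) j ⟨b₀.src.shift lam, b₀.dir⟩ b₁ -
              hlKer (P := P) ((P.eta k) ^ P.d) ((P.L : ℝ) ^ k) (r / 16) (r / 8) j b₀ b₁) ⟨x, μ⟩ b₁ *
          (fun b₁ b₂ : PBond P j => cKer (P := P) ((P.eta k) ^ P.d) ((P.L : ℝ) ^ k) j b₁ b₂ -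
            clKer (P := P) ((P.eta k) ^ P.d) ((P.L : ℝ) ^ k) (r / 4) j b₁ b₂) b₁ b₂ *
          hKer (P := P) ((P.eta k) ^ P.d) ((P.L : ℝ) ^ k) j b'' b₂| *
            Real.exp (min (δ / 2) δC / 2 * kdist (P := P) k b'' ⟨x, μ⟩)) +
          ∑ b'' : PBond P 0, |∑ b₁ : PBond P j, ∑ b₂ : PBond P j,
        (fun (b₀ : PBond P 0) (b₁ : PBond P j) =>
            hlKer (P := P) ((P.eta k) ^ P.d) ((P.L : ℝ) ^ k) (r / 16) (r / 8) j ⟨b₀.src.shift lam, b₀.dir⟩ b₁ -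
              hlKer (P := P) ((P.eta k) ^ P.d) ((P.L : ℝ) ^ k) (r / 16) (r / 8) j b₀ b₁) ⟨x, μ⟩ b₁ *
          clKer (P := P) ((P.eta k) ^ P.d) ((P.L : ℝ) ^ k) (r / 4) j b₁ b₂ *
          (fun (b₀ : PBond P 0) (b₁ : PBond P j) => hKer (P := P) ((P.eta k) ^ P.d) ((P.L : ℝ) ^ k) j b₀ b₁ -
            hlKer (P := P) ((P.eta k) ^ P.d) ((P.L : ℝ) ^ k) (r / 16) (r / 8) j b₀ b₁) b'' b₂| *
            Real.exp (min (δ / 2) δC / 2 * kdist (P := P) k b'' ⟨x, μ⟩)) := by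
        rw [← Finset.mul_sum, Finset.sum_add_distrib, Finset.sum_add_distrib]
    _ ≤ (P.eta k) ^ P.d * (P.L : ℝ) ^ k *
          ((((P.L : ℝ) ^ j)⁻¹ * (M * (1 + 16 * C / r) * Real.exp (δ / 2) * Real.exp (-(δ / 2 * (r / 16))))) * M *
              (MC * ℓ ^ (P.d - 2)) * (P.d : ℝ) ^ 3 *
              (Real.exp (min (δ / 2) δC / 2 / 2) * ((2 * (1 + P.d / (min (δ / 2) δC / 2))) ^ P.d) ^ 3) * ((P.L : ℝ) ^ j) ^ P.d +
            (((P.L : ℝ) ^ j)⁻¹ * (M * (1 + 16 * C / r))) * M * (ℓ ^ (P.d - 2) * MC * Real.exp (-(δC / 4 * r))) * (P.d : ℝ) ^ 3 *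
              (Real.exp (min (δ / 2) δC / 2 / 2) * ((2 * (1 + P.d / (min (δ / 2) δC / 2))) ^ P.d) ^ 3) * ((P.L : ℝ) ^ j) ^ P.d +
            (((P.L : ℝ) ^ j)⁻¹ * (M * (1 + 16 * C / r))) * (M * Real.exp (-(δ / 2 * (r / 16)))) * (MC * ℓ ^ (P.d - 2)) *
              (P.d : ℝ) ^ 3 * (Real.exp (min (δ / 2) δC / 2 / 2) * ((2 * (1 + P.d / (min (δ / 2) δC / 2))) ^ P.d) ^ 3) *
              ((P.L : ℝ) ^ j) ^ P.d) :=
        mul_le_mul_of_nonneg_left (add_le_add (add_le_add t1 t2) t3) (mul_pos hw hLk).le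
    _ = (1 + 16 * C / r) * ((Real.exp (δ / 2) + 1) * Real.exp (-(δ / 2 * (r / 16))) + Real.exp (-(δC / 4 * r))) *
          (M ^ 2 * MC * (P.d : ℝ) ^ 3 * (Real.exp (min (δ / 2) δC / 2 / 2) * ((2 * (1 + P.d / (min (δ / 2) δC / 2))) ^ P.d) ^ 3)) *
          ((P.eta k) ^ P.d * (P.L : ℝ) ^ k * (((P.L : ℝ) ^ j)⁻¹ * ℓ ^ (P.d - 2) * ((P.L : ℝ) ^ j) ^ P.d)) := by ring
    _ = _ := by rw [hscal]

/-- **THE `η`-LATTICE ROW SUMS OF THE OUTPUT-DIFFERENCED `𝒟_k − 𝒟_{k,loc}` AGAINST THE EXPONENTIAL WEIGHT ARE `≲ e^{−cρ_k}`, uniformly in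
`k ≤ m + K`**: for schedules with `ρ_j ≥ ρ₀ > 0` and `ρ_k ≤ ρ_j` (`j < k`),
`Σ_{b″} η_k^dL^k|(𝒟_k − 𝒟_{k,loc})(⟨x+e_λ,μ⟩,b″) − (𝒟_k − 𝒟_{k,loc})(⟨x,μ⟩,b″)|e^{a·dist_k(b″,⟨x,μ⟩)} ≤ (1 + 16C_σ/ρ₀)(e^{δ/2} + 2)M²M_C·d³e^{a/2}K(a)³·e^{−cρ_k}`,
`a = min(δ/2,δ_C)/2`, `c = min(δ/32,δ_C/4)` — the scale terms `≲ (L^{k−j})^{−1}` are summable with no threshold (p. 282: *"Σ_j(L^jη)^{…}e^{−cr(e_j)}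
≦ e^{−cr(e_k)}"*). [cite: BalabanImbrieJaffe1988, (2.13) p.261] -/
theorem weighted_rowsum_gradDkSubDkLoc_le (hd : 2 ≤ P.d) {k : ℕ} (hk : k ≤ P.m + P.K) {a : ℝ} (ha : 0 < a) {δ M δC MC : ℝ}
    (hδ : 0 < δ) (hδC : 0 < δC) (hM : 0 ≤ M) (hMC : 0 ≤ MC)
    (hH : ∀ (j : ℕ) (hj : j ≤ P.m + P.K), j < k → ∀ (μ ν : Fin P.d) (x : TSite P 0) (y : TSite P j),
      |(torusRep P j (deltaAData hj a)).H (x, μ) (y, ν)| ≤ M * Real.exp (-(δ * distEU P j x y)))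
    (hB : ∀ (j : ℕ) (hj : j ≤ P.m + P.K), j < k → ∀ (μ ν : Fin P.d) (x : TSite P 0) (y : TSite P j),
      ‖fun lam : Fin P.d => (P.L : ℝ) ^ j *
          ((torusRep P j (deltaAData hj a)).H (x.shift lam, μ) (y, ν) - (torusRep P j (deltaAData hj a)).H (x, μ) (y, ν))‖ ≤
        M * Real.exp (-(δ * distEU P j x y)))
    {C : ℝ} (hC0 : 0 ≤ C) (hCζ : ∀ (R₁ R₀ : ℝ), R₁ < R₀ → ∀ t s : ℝ,
      |cutoffProfile R₁ R₀ t - cutoffProfile R₁ R₀ s| ≤ C / (R₀ - R₁) * |t - s|)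
    (ρ : ℕ → ℝ) {ρ₀ : ℝ} (hρ₀ : 0 < ρ₀) (hρ : ∀ j < k, ρ₀ ≤ ρ j) (hmono : ∀ j < k, ρ k ≤ ρ j)
    (hCm : ∀ j < k, ∀ b₁ b₂ : PBond P j, |Cmat P j b₁ b₂| ≤ MC * Real.exp (-(δC * (supDist b₁.src b₂.src : ℝ))))
    (hCl : ∀ j < k, ∀ b₁ b₂ : PBond P j, |Cloc P j (ρ j / 4) b₁ b₂| ≤ MC * Real.exp (-(δC * (supDist b₁.src b₂.src : ℝ))))
    (hCd : ∀ j < k, ∀ b₁ b₂ : PBond P j, |Cloc P j (ρ j / 4) b₁ b₂ - Cmat P j b₁ b₂| ≤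
      MC * Real.exp (-(δC / 4 * ρ j)) * Real.exp (-(δC * (supDist b₁.src b₂.src : ℝ))))
    (x : TSite P 0) (μ lam : Fin P.d) :
    ∑ b'' : PBond P 0, (P.eta k) ^ P.d * (P.L : ℝ) ^ k *
        |(DkE P ((P.eta k) ^ P.d) ((P.L : ℝ) ^ k) k (toE P (Pi.single b'' 1)) ⟨x.shift lam, μ⟩ -
            dkLocKer (P := P) ((P.eta k) ^ P.d) ((P.L : ℝ) ^ k) ρ k ⟨x.shift lam, μ⟩ b'') -
          (DkE P ((P.eta k) ^ P.d) ((P.L : ℝ) ^ k) k (toE P (Pi.single b'' 1)) ⟨x, μ⟩ -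
            dkLocKer (P := P) ((P.eta k) ^ P.d) ((P.L : ℝ) ^ k) ρ k ⟨x, μ⟩ b'')| *
        Real.exp (min (δ / 2) δC / 2 * kdist (P := P) k b'' ⟨x, μ⟩) ≤
      (1 + 16 * C / ρ₀) * (Real.exp (δ / 2) + 2) *
        (M ^ 2 * MC * (P.d : ℝ) ^ 3 * (Real.exp (min (δ / 2) δC / 2 / 2) * ((2 * (1 + P.d / (min (δ / 2) δC / 2))) ^ P.d) ^ 3)) *
        Real.exp (-(min (δ / 32) (δC / 4) * ρ k)) := by
  have hw : 0 ≤ (P.eta k) ^ P.d * (P.L : ℝ) ^ k := (mul_pos (pow_pos (eta_pos P k) _) (cast_pow_L_pos' k)).le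
  set S : ℝ := M ^ 2 * MC * (P.d : ℝ) ^ 3 * (Real.exp (min (δ / 2) δC / 2 / 2) * ((2 * (1 + P.d / (min (δ / 2) δC / 2))) ^ P.d) ^ 3)
    with hS
  have hS0 : 0 ≤ S := by positivity
  have hfac0 : 0 ≤ 1 + 16 * C / ρ₀ := by positivity
  have hcc1 : min (δ / 32) (δC / 4) ≤ δ / 32 := min_le_left _ _
  have hcc2 : min (δ / 32) (δC / 4) ≤ δC / 4 := min_le_right _ _
  -- the smallness factors of the scales
  have hsmall : ∀ j < k, (Real.exp (δ / 2) + 1) * Real.exp (-(δ / 2 * (ρ j / 16))) + Real.exp (-(δC / 4 * ρ j)) ≤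
      (Real.exp (δ / 2) + 2) * Real.exp (-(min (δ / 32) (δC / 4) * ρ k)) := by
    intro j hjk
    have hρj : 0 < ρ j := lt_of_lt_of_le hρ₀ (hρ j hjk)
    have hkj : ρ k ≤ ρ j := hmono j hjk
    have e1 : Real.exp (-(δ / 2 * (ρ j / 16))) ≤ Real.exp (-(min (δ / 32) (δC / 4) * ρ k)) := by
      refine Real.exp_le_exp.2 ?_
      have : min (δ / 32) (δC / 4) * ρ k ≤ δ / 32 * ρ j :=
        (mul_le_mul_of_nonneg_left hkj (le_min (by positivity) (by positivity))).trans
          (mul_le_mul_of_nonneg_right hcc1 hρj.le)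
      linarith
    have e2 : Real.exp (-(δC / 4 * ρ j)) ≤ Real.exp (-(min (δ / 32) (δC / 4) * ρ k)) := by
      refine Real.exp_le_exp.2 ?_
      have : min (δ / 32) (δC / 4) * ρ k ≤ δC / 4 * ρ j :=
        (mul_le_mul_of_nonneg_left hkj (le_min (by positivity) (by positivity))).trans
          (mul_le_mul_of_nonneg_right hcc2 hρj.le)
      linarith
    have hE0 : 0 ≤ Real.exp (δ / 2) + 1 := by positivity
    nlinarith [mul_le_mul_of_nonneg_left e1 hE0]
  have hterm : ∀ j ∈ Finset.range k, ∑ b'' : PBond P 0, (P.eta k) ^ P.d * (P.L : ℝ) ^ k *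
      |(∑ b₁ : PBond P j, ∑ b₂ : PBond P j,
          (hKer (P := P) ((P.eta k) ^ P.d) ((P.L : ℝ) ^ k) j ⟨x.shift lam, μ⟩ b₁ *
              cKer (P := P) ((P.eta k) ^ P.d) ((P.L : ℝ) ^ k) j b₁ b₂ * hKer (P := P) ((P.eta k) ^ P.d) ((P.L : ℝ) ^ k) j b'' b₂ -
            hlKer (P := P) ((P.eta k) ^ P.d) ((P.L : ℝ) ^ k) (ρ j / 16) (ρ j / 8) j ⟨x.shift lam, μ⟩ b₁ *
                clKer (P := P) ((P.eta k) ^ P.d) ((P.L : ℝ) ^ k) (ρ j / 4) j b₁ b₂ *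
              hlKer (P := P) ((P.eta k) ^ P.d) ((P.L : ℝ) ^ k) (ρ j / 16) (ρ j / 8) j b'' b₂)) -
        (∑ b₁ : PBond P j, ∑ b₂ : PBond P j,
          (hKer (P := P) ((P.eta k) ^ P.d) ((P.L : ℝ) ^ k) j ⟨x, μ⟩ b₁ *
              cKer (P := P) ((P.eta k) ^ P.d) ((P.L : ℝ) ^ k) j b₁ b₂ * hKer (P := P) ((P.eta k) ^ P.d) ((P.L : ℝ) ^ k) j b'' b₂ -
            hlKer (P := P) ((P.eta k) ^ P.d) ((P.L : ℝ) ^ k) (ρ j / 16) (ρ j / 8) j ⟨x, μ⟩ b₁ *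
                clKer (P := P) ((P.eta k) ^ P.d) ((P.L : ℝ) ^ k) (ρ j / 4) j b₁ b₂ *
              hlKer (P := P) ((P.eta k) ^ P.d) ((P.L : ℝ) ^ k) (ρ j / 16) (ρ j / 8) j b'' b₂))| *
        Real.exp (min (δ / 2) δC / 2 * kdist (P := P) k b'' ⟨x, μ⟩) ≤
      (1 + 16 * C / ρ₀) * (Real.exp (δ / 2) + 2) * S * Real.exp (-(min (δ / 32) (δC / 4) * ρ k)) * ((P.L : ℝ) ^ (k - j))⁻¹ := by
    intro j hjm
    have hjk : j < k := Finset.mem_range.1 hjm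
    have hj : j ≤ P.m + P.K := by omega
    have hρj : 0 < ρ j := lt_of_lt_of_le hρ₀ (hρ j hjk)
    have hfac : 1 + 16 * C / ρ j ≤ 1 + 16 * C / ρ₀ := by
      have := div_le_div_of_nonneg_left (by positivity : 0 ≤ 16 * C) hρ₀ (hρ j hjk)
      linarith
    refine (weighted_rowsum_gradDiffTerm_le hd hj hjk.le ha hδ hδC hM hMC (hH j hj hjk) (hB j hj hjk) hC0 hCζ hρj (hCm j hjk)
      (hCl j hjk) (hCd j hjk) x μ lam).trans ?_
    refine mul_le_mul_of_nonneg_right ?_ (inv_pos.2 (cast_pow_L_pos' _)).le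
    have hsm := hsmall j hjk
    have hsm0 : 0 ≤ (Real.exp (δ / 2) + 1) * Real.exp (-(δ / 2 * (ρ j / 16))) + Real.exp (-(δC / 4 * ρ j)) := by positivity
    calc (1 + 16 * C / ρ j) * ((Real.exp (δ / 2) + 1) * Real.exp (-(δ / 2 * (ρ j / 16))) + Real.exp (-(δC / 4 * ρ j))) * S
        ≤ (1 + 16 * C / ρ₀) * ((Real.exp (δ / 2) + 2) * Real.exp (-(min (δ / 32) (δC / 4) * ρ k))) * S :=
          mul_le_mul_of_nonneg_right (mul_le_mul hfac hsm hsm0 hfac0) hS0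
      _ = _ := by ring
  calc ∑ b'' : PBond P 0, (P.eta k) ^ P.d * (P.L : ℝ) ^ k *
          |(DkE P ((P.eta k) ^ P.d) ((P.L : ℝ) ^ k) k (toE P (Pi.single b'' 1)) ⟨x.shift lam, μ⟩ -
              dkLocKer (P := P) ((P.eta k) ^ P.d) ((P.L : ℝ) ^ k) ρ k ⟨x.shift lam, μ⟩ b'') -
            (DkE P ((P.eta k) ^ P.d) ((P.L : ℝ) ^ k) k (toE P (Pi.single b'' 1)) ⟨x, μ⟩ -
              dkLocKer (P := P) ((P.eta k) ^ P.d) ((P.L : ℝ) ^ k) ρ k ⟨x, μ⟩ b'')| *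
          Real.exp (min (δ / 2) δC / 2 * kdist (P := P) k b'' ⟨x, μ⟩)
      ≤ ∑ b'' : PBond P 0, ∑ j ∈ Finset.range k, (P.eta k) ^ P.d * (P.L : ℝ) ^ k *
      |(∑ b₁ : PBond P j, ∑ b₂ : PBond P j,
          (hKer (P := P) ((P.eta k) ^ P.d) ((P.L : ℝ) ^ k) j ⟨x.shift lam, μ⟩ b₁ *
              cKer (P := P) ((P.eta k) ^ P.d) ((P.L : ℝ) ^ k) j b₁ b₂ * hKer (P := P) ((P.eta k) ^ P.d) ((P.L : ℝ) ^ k) j b'' b₂ -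
            hlKer (P := P) ((P.eta k) ^ P.d) ((P.L : ℝ) ^ k) (ρ j / 16) (ρ j / 8) j ⟨x.shift lam, μ⟩ b₁ *
                clKer (P := P) ((P.eta k) ^ P.d) ((P.L : ℝ) ^ k) (ρ j / 4) j b₁ b₂ *
              hlKer (P := P) ((P.eta k) ^ P.d) ((P.L : ℝ) ^ k) (ρ j / 16) (ρ j / 8) j b'' b₂)) -
        (∑ b₁ : PBond P j, ∑ b₂ : PBond P j,
          (hKer (P := P) ((P.eta k) ^ P.d) ((P.L : ℝ) ^ k) j ⟨x, μ⟩ b₁ *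
              cKer (P := P) ((P.eta k) ^ P.d) ((P.L : ℝ) ^ k) j b₁ b₂ * hKer (P := P) ((P.eta k) ^ P.d) ((P.L : ℝ) ^ k) j b'' b₂ -
            hlKer (P := P) ((P.eta k) ^ P.d) ((P.L : ℝ) ^ k) (ρ j / 16) (ρ j / 8) j ⟨x, μ⟩ b₁ *
                clKer (P := P) ((P.eta k) ^ P.d) ((P.L : ℝ) ^ k) (ρ j / 4) j b₁ b₂ *
              hlKer (P := P) ((P.eta k) ^ P.d) ((P.L : ℝ) ^ k) (ρ j / 16) (ρ j / 8) j b'' b₂))| *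
        Real.exp (min (δ / 2) δC / 2 * kdist (P := P) k b'' ⟨x, μ⟩) := by
        refine Finset.sum_le_sum fun b'' _ => ?_
        rw [dk_sub_dkLoc_eq_sum, dk_sub_dkLoc_eq_sum, ← Finset.sum_sub_distrib, ← Finset.sum_mul, ← Finset.mul_sum]
        exact mul_le_mul_of_nonneg_right (mul_le_mul_of_nonneg_left (Finset.abs_sum_le_sum_abs _ _) hw) (Real.exp_pos _).le
    _ = ∑ j ∈ Finset.range k, ∑ b'' : PBond P 0, (P.eta k) ^ P.d * (P.L : ℝ) ^ k *
      |(∑ b₁ : PBond P j, ∑ b₂ : PBond P j,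
          (hKer (P := P) ((P.eta k) ^ P.d) ((P.L : ℝ) ^ k) j ⟨x.shift lam, μ⟩ b₁ *
              cKer (P := P) ((P.eta k) ^ P.d) ((P.L : ℝ) ^ k) j b₁ b₂ * hKer (P := P) ((P.eta k) ^ P.d) ((P.L : ℝ) ^ k) j b'' b₂ -
            hlKer (P := P) ((P.eta k) ^ P.d) ((P.L : ℝ) ^ k) (ρ j / 16) (ρ j / 8) j ⟨x.shift lam, μ⟩ b₁ *
                clKer (P := P) ((P.eta k) ^ P.d) ((P.L : ℝ) ^ k) (ρ j / 4) j b₁ b₂ *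
              hlKer (P := P) ((P.eta k) ^ P.d) ((P.L : ℝ) ^ k) (ρ j / 16) (ρ j / 8) j b'' b₂)) -
        (∑ b₁ : PBond P j, ∑ b₂ : PBond P j,
          (hKer (P := P) ((P.eta k) ^ P.d) ((P.L : ℝ) ^ k) j ⟨x, μ⟩ b₁ *
              cKer (P := P) ((P.eta k) ^ P.d) ((P.L : ℝ) ^ k) j b₁ b₂ * hKer (P := P) ((P.eta k) ^ P.d) ((P.L : ℝ) ^ k) j b'' b₂ -
            hlKer (P := P) ((P.eta k) ^ P.d) ((P.L : ℝ) ^ k) (ρ j / 16) (ρ j / 8) j ⟨x, μ⟩ b₁ *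
                clKer (P := P) ((P.eta k) ^ P.d) ((P.L : ℝ) ^ k) (ρ j / 4) j b₁ b₂ *
              hlKer (P := P) ((P.eta k) ^ P.d) ((P.L : ℝ) ^ k) (ρ j / 16) (ρ j / 8) j b'' b₂))| *
        Real.exp (min (δ / 2) δC / 2 * kdist (P := P) k b'' ⟨x, μ⟩) := Finset.sum_comm
    _ ≤ ∑ j ∈ Finset.range k, (1 + 16 * C / ρ₀) * (Real.exp (δ / 2) + 2) * S * Real.exp (-(min (δ / 32) (δC / 4) * ρ k)) *
          ((P.L : ℝ) ^ (k - j))⁻¹ := Finset.sum_le_sum hterm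
    _ = (1 + 16 * C / ρ₀) * (Real.exp (δ / 2) + 2) * S * Real.exp (-(min (δ / 32) (δC / 4) * ρ k)) *
          ∑ j ∈ Finset.range k, ((P.L : ℝ) ^ (k - j))⁻¹ := by rw [Finset.mul_sum]
    _ ≤ (1 + 16 * C / ρ₀) * (Real.exp (δ / 2) + 2) * S * Real.exp (-(min (δ / 32) (δC / 4) * ρ k)) * 1 :=
        mul_le_mul_of_nonneg_left (sum_inv_pow_le_one k) (by positivity)
    _ = _ := by rw [mul_one]

/-! ## §3  The operator form of the derivative: all `x, μ, λ`, no threshold -/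

/-- **THE `η`-DERIVATIVE OF THE OPERATOR CLOSENESS, EXPLICIT CONSTANTS, ALL `x, μ, λ`** (every `d ≥ 2`): with the `η`-lattice action
`((𝒟_k − 𝒟_{k,loc})f)(b) = Σ_{b″}η_k^d(𝒟_k − 𝒟_{k,loc})(b,b″)f(b″)`, `L^k·|((𝒟_k − 𝒟_{k,loc})f)(⟨x+e_λ,μ⟩) − ((𝒟_k − 𝒟_{k,loc})f)(⟨x,μ⟩)| ≤
(1 + 16C_σ/ρ₀)(e^{δ/2} + 2)M²M_C·d³e^{a/2}K(a)³·e^{−cρ_k}·e^{−a·dist_k(suppt f,⟨x,μ⟩)}‖f‖_∞`, `a = min(δ/2,δ_C)/2`, `c = min(δ/32,δ_C/4)`, every `k ≤ m + K`,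
every schedule with `ρ_j ≥ ρ₀ > 0`, `ρ_k ≤ ρ_j` (`j < k`) — the printed *"|(∂w′₁)(p,b′)| ≦ … ≦ e^{−cr(e_k)}e^{−c dist(p,b′)}"* mechanism for the
undressed kernel. [cite: BalabanImbrieJaffe1988, (2.13) p.261] -/
theorem abs_apply_gradDkSubDkLoc_le (hd : 2 ≤ P.d) {k : ℕ} (hk : k ≤ P.m + P.K) {a : ℝ} (ha : 0 < a) {δ M δC MC : ℝ}
    (hδ : 0 < δ) (hδC : 0 < δC) (hM : 0 ≤ M) (hMC : 0 ≤ MC)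
    (hH : ∀ (j : ℕ) (hj : j ≤ P.m + P.K), j < k → ∀ (μ ν : Fin P.d) (x : TSite P 0) (y : TSite P j),
      |(torusRep P j (deltaAData hj a)).H (x, μ) (y, ν)| ≤ M * Real.exp (-(δ * distEU P j x y)))
    (hB : ∀ (j : ℕ) (hj : j ≤ P.m + P.K), j < k → ∀ (μ ν : Fin P.d) (x : TSite P 0) (y : TSite P j),
      ‖fun lam : Fin P.d => (P.L : ℝ) ^ j *
          ((torusRep P j (deltaAData hj a)).H (x.shift lam, μ) (y, ν) - (torusRep P j (deltaAData hj a)).H (x, μ) (y, ν))‖ ≤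
        M * Real.exp (-(δ * distEU P j x y)))
    {C : ℝ} (hC0 : 0 ≤ C) (hCζ : ∀ (R₁ R₀ : ℝ), R₁ < R₀ → ∀ t s : ℝ,
      |cutoffProfile R₁ R₀ t - cutoffProfile R₁ R₀ s| ≤ C / (R₀ - R₁) * |t - s|)
    (ρ : ℕ → ℝ) {ρ₀ : ℝ} (hρ₀ : 0 < ρ₀) (hρ : ∀ j < k, ρ₀ ≤ ρ j) (hmono : ∀ j < k, ρ k ≤ ρ j)
    (hCm : ∀ j < k, ∀ b₁ b₂ : PBond P j, |Cmat P j b₁ b₂| ≤ MC * Real.exp (-(δC * (supDist b₁.src b₂.src : ℝ))))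
    (hCl : ∀ j < k, ∀ b₁ b₂ : PBond P j, |Cloc P j (ρ j / 4) b₁ b₂| ≤ MC * Real.exp (-(δC * (supDist b₁.src b₂.src : ℝ))))
    (hCd : ∀ j < k, ∀ b₁ b₂ : PBond P j, |Cloc P j (ρ j / 4) b₁ b₂ - Cmat P j b₁ b₂| ≤
      MC * Real.exp (-(δC / 4 * ρ j)) * Real.exp (-(δC * (supDist b₁.src b₂.src : ℝ))))
    (f : PBond P 0 → ℝ) (x : TSite P 0) (μ lam : Fin P.d) :
    (P.L : ℝ) ^ k * |applyK (fun b b'' => (P.eta k) ^ P.d * (DkE P ((P.eta k) ^ P.d) ((P.L : ℝ) ^ k) k (toE P (Pi.single b'' 1)) b -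
          dkLocKer (P := P) ((P.eta k) ^ P.d) ((P.L : ℝ) ^ k) ρ k b b'')) f ⟨x.shift lam, μ⟩ -
        applyK (fun b b'' => (P.eta k) ^ P.d * (DkE P ((P.eta k) ^ P.d) ((P.L : ℝ) ^ k) k (toE P (Pi.single b'' 1)) b -
          dkLocKer (P := P) ((P.eta k) ^ P.d) ((P.L : ℝ) ^ k) ρ k b b'')) f ⟨x, μ⟩| ≤
      (1 + 16 * C / ρ₀) * (Real.exp (δ / 2) + 2) *
          (M ^ 2 * MC * (P.d : ℝ) ^ 3 * (Real.exp (min (δ / 2) δC / 2 / 2) * ((2 * (1 + P.d / (min (δ / 2) δC / 2))) ^ P.d) ^ 3)) *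
          Real.exp (-(min (δ / 32) (δC / 4) * ρ k)) *
        Real.exp (-(min (δ / 2) δC / 2) * suppDist (fun a b => kdist (P := P) k a b) f ⟨x, μ⟩) * supNorm f := by
  have hLk : 0 < (P.L : ℝ) ^ k := cast_pow_L_pos' k
  have hw : 0 ≤ (P.eta k) ^ P.d := (pow_pos (eta_pos P k) _).le
  have ha₀ : 0 ≤ min (δ / 2) δC / 2 := (half_pos (lt_min (half_pos hδ) hδC)).le
  rw [mul_abs_of_pos hLk, applyK_shift_sub]
  refine abs_applyK_le_of_weighted_rowsum (dist := fun a b => kdist (P := P) k a b) ha₀ ?_ f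
  have e : ∀ b'' : PBond P 0,
      |(P.L : ℝ) ^ k * ((P.eta k) ^ P.d * (DkE P ((P.eta k) ^ P.d) ((P.L : ℝ) ^ k) k (toE P (Pi.single b'' 1)) ⟨x.shift lam, μ⟩ -
            dkLocKer (P := P) ((P.eta k) ^ P.d) ((P.L : ℝ) ^ k) ρ k ⟨x.shift lam, μ⟩ b'') -
          (P.eta k) ^ P.d * (DkE P ((P.eta k) ^ P.d) ((P.L : ℝ) ^ k) k (toE P (Pi.single b'' 1)) ⟨x, μ⟩ -
            dkLocKer (P := P) ((P.eta k) ^ P.d) ((P.L : ℝ) ^ k) ρ k ⟨x, μ⟩ b''))| =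
        (P.eta k) ^ P.d * (P.L : ℝ) ^ k *
          |(DkE P ((P.eta k) ^ P.d) ((P.L : ℝ) ^ k) k (toE P (Pi.single b'' 1)) ⟨x.shift lam, μ⟩ -
              dkLocKer (P := P) ((P.eta k) ^ P.d) ((P.L : ℝ) ^ k) ρ k ⟨x.shift lam, μ⟩ b'') -
            (DkE P ((P.eta k) ^ P.d) ((P.L : ℝ) ^ k) k (toE P (Pi.single b'' 1)) ⟨x, μ⟩ -
              dkLocKer (P := P) ((P.eta k) ^ P.d) ((P.L : ℝ) ^ k) ρ k ⟨x, μ⟩ b'')| := by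
    intro b''
    rw [← mul_sub, ← mul_assoc, abs_mul, abs_of_nonneg (mul_nonneg hLk.le hw), mul_comm ((P.L : ℝ) ^ k)]
  simp only [e]
  exact weighted_rowsum_gradDkSubDkLoc_le hd hk ha hδ hδC hM hMC hH hB hC0 hCζ ρ hρ₀ hρ hmono hCm hCl hCd x μ lam

/-- **THE `η`-DERIVATIVE OF THE OPERATOR CLOSENESS ON A TORUS FROM THE TYPED (I.7.2.2)** (r15's `KernelData.Ineq722` for p09's kernel family;
C-side hypothesis-free by p09's `cloc_estimates`, cutoff slope by file E1): for radii bounded below by `ρ₀ > 0`,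
`∃ c₀ c δ′, 0 < c ∧ 0 < δ′ ∧ 0 ≤ c₀ ∧ ∀ k ≤ m + K, ∀ ρ (ρ_j ≥ ρ₀, ρ_k ≤ ρ_j for j < k), ∀ f x μ λ,
L^k·|((𝒟_k − 𝒟_{k,loc})f)(⟨x+e_λ,μ⟩) − ((𝒟_k − 𝒟_{k,loc})f)(⟨x,μ⟩)| ≤ c₀e^{−cρ_k}e^{−δ′dist_k(suppt f,⟨x,μ⟩)}‖f‖_∞`. [cite: BalabanImbrieJaffe1988, (2.13) p.261] -/
theorem opCloseGrad_dkLoc_of_ineq722 (hd : 2 ≤ P.d) {lev : ℕ → ℕ} (hlev : ∀ i, lev i ≤ P.m + P.K)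
    (hcov : ∀ j ≤ P.m + P.K, ∃ i, lev i = j) {a : ℝ} {BondU : ℕ → Type}
    {distEB : (i : ℕ) → TSite P 0 → BondU i → ℝ} {Cker : (i : ℕ) → Fin P.d → Fin P.d → TSite P (lev i) → TSite P (lev i) → ℝ}
    {Dker : (i : ℕ) → TSite P 0 → BondU i → ℝ}
    (h722 : KernelData.Ineq722
      (fun i => torusKernelData P (lev i) (deltaAData (hlev i) a) (BondU i) (distEB i) (Cker i) (Dker i))) (ha : 0 < a)
    {ρ₀ : ℝ} (hρ₀ : 0 < ρ₀) :
    ∃ c₀ c δ' : ℝ, 0 < c ∧ 0 < δ' ∧ 0 ≤ c₀ ∧ ∀ (k : ℕ) (_ : k ≤ P.m + P.K) (ρ : ℕ → ℝ),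
      (∀ j < k, ρ₀ ≤ ρ j) → (∀ j < k, ρ k ≤ ρ j) → ∀ (f : PBond P 0 → ℝ) (x : TSite P 0) (μ lam : Fin P.d),
        (P.L : ℝ) ^ k * |applyK (fun b b'' => (P.eta k) ^ P.d * (DkE P ((P.eta k) ^ P.d) ((P.L : ℝ) ^ k) k (toE P (Pi.single b'' 1)) b -
              dkLocKer (P := P) ((P.eta k) ^ P.d) ((P.L : ℝ) ^ k) ρ k b b'')) f ⟨x.shift lam, μ⟩ -
            applyK (fun b b'' => (P.eta k) ^ P.d * (DkE P ((P.eta k) ^ P.d) ((P.L : ℝ) ^ k) k (toE P (Pi.single b'' 1)) b -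
              dkLocKer (P := P) ((P.eta k) ^ P.d) ((P.L : ℝ) ^ k) ρ k b b'')) f ⟨x, μ⟩| ≤
          c₀ * Real.exp (-(c * ρ k)) * Real.exp (-δ' * suppDist (fun a b => kdist (P := P) k a b) f ⟨x, μ⟩) * supNorm f := by
  classical
  obtain ⟨δ, M, hδ, hM, hBall⟩ := exists_bound_of_ineq722 hlev h722
  obtain ⟨MC, δ₀, hMC, hδ₀, HC⟩ := cloc_estimates P.d P.L hd
  obtain ⟨C, hC0, hCζ⟩ := exists_cutoffProfile_lipschitz
  have hδC : 0 < δ₀ / 2 := half_pos hδ₀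
  refine ⟨(1 + 16 * C / ρ₀) * (Real.exp (δ / 2) + 2) * (M ^ 2 * (MC * (Real.exp (4 * δ₀ * P.L) * (1 + P.L) ^ 2)) * (P.d : ℝ) ^ 3 *
      (Real.exp (min (δ / 2) (δ₀ / 2) / 2 / 2) * ((2 * (1 + P.d / (min (δ / 2) (δ₀ / 2) / 2))) ^ P.d) ^ 3)),
    min (δ / 32) (δ₀ / 2 / 4), min (δ / 2) (δ₀ / 2) / 2, lt_min (by positivity) (by positivity),
    half_pos (lt_min (half_pos hδ) hδC), by positivity, fun k hk ρ hρ hmono f x μ lam => ?_⟩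
  have hH : ∀ (j : ℕ) (hj : j ≤ P.m + P.K), j < k → ∀ (μ ν : Fin P.d) (x : TSite P 0) (y : TSite P j),
      |(torusRep P j (deltaAData hj a)).H (x, μ) (y, ν)| ≤ M * Real.exp (-(δ * distEU P j x y)) := by
    intro j hj _ μ ν x y
    obtain ⟨i, hi⟩ := hcov j hj
    subst hi
    exact (le_add_of_nonneg_right torusKernelData_gradH_nonneg).trans (hBall i μ ν x y)
  have hB : ∀ (j : ℕ) (hj : j ≤ P.m + P.K), j < k → ∀ (μ ν : Fin P.d) (x : TSite P 0) (y : TSite P j),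
      ‖fun lam : Fin P.d => (P.L : ℝ) ^ j *
          ((torusRep P j (deltaAData hj a)).H (x.shift lam, μ) (y, ν) - (torusRep P j (deltaAData hj a)).H (x, μ) (y, ν))‖ ≤
        M * Real.exp (-(δ * distEU P j x y)) := by
    intro j hj _ μ ν x y
    obtain ⟨i, hi⟩ := hcov j hj
    subst hi
    have h := hBall i μ ν x y
    rw [torusKernelData_gradH] at h
    exact (le_add_of_nonneg_left (abs_nonneg _)).trans h
  have hC : ∀ j < k, (∀ b₁ b₂ : PBond P j, |Cmat P j b₁ b₂| ≤
        MC * (Real.exp (4 * δ₀ * P.L) * (1 + P.L) ^ 2) * Real.exp (-(δ₀ / 2 * (supDist b₁.src b₂.src : ℝ)))) ∧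
      (∀ b₁ b₂ : PBond P j, |Cloc P j (ρ j / 4) b₁ b₂| ≤
        MC * (Real.exp (4 * δ₀ * P.L) * (1 + P.L) ^ 2) * Real.exp (-(δ₀ / 2 * (supDist b₁.src b₂.src : ℝ)))) ∧
      (∀ b₁ b₂ : PBond P j, |Cloc P j (ρ j / 4) b₁ b₂ - Cmat P j b₁ b₂| ≤
        MC * (Real.exp (4 * δ₀ * P.L) * (1 + P.L) ^ 2) * Real.exp (-(δ₀ / 2 / 4 * ρ j)) *
          Real.exp (-(δ₀ / 2 * (supDist b₁.src b₂.src : ℝ)))) :=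
    fun j hjk => cSide_of_cloc_estimates hMC hδ₀ (fun R b b' => HC P rfl rfl j inferInstance (by omega) R b b') (ρ j)
  rw [neg_mul]
  exact (abs_apply_gradDkSubDkLoc_le hd hk ha hδ hδC hM (by positivity) hH hB hC0 hCζ ρ hρ₀ hρ hmono (fun j hjk => (hC j hjk).1)
    (fun j hjk => (hC j hjk).2.1) (fun j hjk => (hC j hjk).2.2) f x μ lam).trans (le_of_eq (by ring))

/-- **THE `η`-DERIVATIVE OF THE OPERATOR CLOSENESS ON EVERY TORUS — NO HYPOTHESIS** (`d ≥ 2`, radii `ρ_j ≥ ρ₀ > 0`; per-tower [6I] Prop. 1.2 is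
p16's theorem, typing note G-C1-07; `a = 1` internally): `∃ c₀ c δ′`, `0 < c`, `0 < δ′`, `0 ≤ c₀`, `∀ k ≤ m + K ∀ ρ` (`ρ_j ≥ ρ₀`, non-increasing
below `k`) `∀ f x μ λ`: `L^k·|((𝒟_k − 𝒟_{k,loc})f)(⟨x+e_λ,μ⟩) − ((𝒟_k − 𝒟_{k,loc})f)(⟨x,μ⟩)| ≤ c₀e^{−cρ_k}e^{−δ′dist_k(suppt f,⟨x,μ⟩)}‖f‖_∞`.
[cite: BalabanImbrieJaffe1988, (2.13) p.261] -/
theorem opCloseGrad_dkLoc_torus (hd : 2 ≤ P.d) {ρ₀ : ℝ} (hρ₀ : 0 < ρ₀) :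
    ∃ c₀ c δ' : ℝ, 0 < c ∧ 0 < δ' ∧ 0 ≤ c₀ ∧ ∀ (k : ℕ) (_ : k ≤ P.m + P.K) (ρ : ℕ → ℝ),
      (∀ j < k, ρ₀ ≤ ρ j) → (∀ j < k, ρ k ≤ ρ j) → ∀ (f : PBond P 0 → ℝ) (x : TSite P 0) (μ lam : Fin P.d),
        (P.L : ℝ) ^ k * |applyK (fun b b'' => (P.eta k) ^ P.d * (DkE P ((P.eta k) ^ P.d) ((P.L : ℝ) ^ k) k (toE P (Pi.single b'' 1)) b -
              dkLocKer (P := P) ((P.eta k) ^ P.d) ((P.L : ℝ) ^ k) ρ k b b'')) f ⟨x.shift lam, μ⟩ -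
            applyK (fun b b'' => (P.eta k) ^ P.d * (DkE P ((P.eta k) ^ P.d) ((P.L : ℝ) ^ k) k (toE P (Pi.single b'' 1)) b -
              dkLocKer (P := P) ((P.eta k) ^ P.d) ((P.L : ℝ) ^ k) ρ k b b'')) f ⟨x, μ⟩| ≤
          c₀ * Real.exp (-(c * ρ k)) * Real.exp (-δ' * suppDist (fun a b => kdist (P := P) k a b) f ⟨x, μ⟩) * supNorm f :=
  opCloseGrad_dkLoc_of_ineq722 hd levStd_le (fun j hj => ⟨j, min_eq_left hj⟩)
    (ineq722_deltaA_of_prop12Printed (levStd P) levStd_le one_pos (fun _ => PUnit) (fun _ _ _ => 0) (fun _ _ _ _ _ => 0)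
      (fun _ _ _ => 0) (prop12Printed_levStd_deltaA P 1)) one_pos hρ₀

/-! ## §4  Over all tori: one set of constants, hypothesis-free -/

/-- **THE `η`-DERIVATIVE OF THE OPERATOR CLOSENESS OVER ALL TORI FROM [6I] PROP. 1.2 BY ITS TREE NAME** (`2 ≤ d`, `L` odd `> 1`, radii
`ρ_j ≥ ρ₀ > 0`): ONE `(c₀, c, δ′)` for EVERY torus (`P.d = d`, `P.L = L`), every `k ≤ m + K`, every admissible schedule, every `f, x, μ, λ`
(this seat's all-tori sup + gradient lemma `exists_HB_allTori_of_prop12Printed`, p09's all-tori `cloc_estimates`). [cite: BalabanImbrieJaffe1988, (2.13) p.261] -/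
theorem opCloseGrad_dkLoc_allTori_of_prop12Printed {d L : ℕ} (hd : 2 ≤ d) (hL : Odd L ∧ 1 < L) {a : ℝ} (ha : 0 < a)
    (h12 : B5.Prop12Printed (fun i : {x : Params × ℕ // x.1.d = d ∧ x.1.L = L ∧ 1 ≤ x.2 ∧ x.2 ≤ x.1.m + x.1.K} =>
      settingOf (torusRep i.1.1 i.1.2 (deltaAData i.2.2.2.2 a)) i.1.2))
    {ρ₀ : ℝ} (hρ₀ : 0 < ρ₀) :
    ∃ c₀ c δ' : ℝ, 0 < c ∧ 0 < δ' ∧ 0 ≤ c₀ ∧ ∀ (P : Params) (_ : P.d = d) (_ : P.L = L) (k : ℕ) (_ : k ≤ P.m + P.K)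
      (ρ : ℕ → ℝ), (∀ j < k, ρ₀ ≤ ρ j) → (∀ j < k, ρ k ≤ ρ j) → ∀ (f : PBond P 0 → ℝ) (x : TSite P 0) (μ lam : Fin P.d),
        (P.L : ℝ) ^ k * |applyK (fun b b'' => (P.eta k) ^ P.d * (DkE P ((P.eta k) ^ P.d) ((P.L : ℝ) ^ k) k (toE P (Pi.single b'' 1)) b -
              dkLocKer (P := P) ((P.eta k) ^ P.d) ((P.L : ℝ) ^ k) ρ k b b'')) f ⟨x.shift lam, μ⟩ -
            applyK (fun b b'' => (P.eta k) ^ P.d * (DkE P ((P.eta k) ^ P.d) ((P.L : ℝ) ^ k) k (toE P (Pi.single b'' 1)) b -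
              dkLocKer (P := P) ((P.eta k) ^ P.d) ((P.L : ℝ) ^ k) ρ k b b'')) f ⟨x, μ⟩| ≤
          c₀ * Real.exp (-(c * ρ k)) * Real.exp (-δ' * suppDist (fun a b => kdist (P := P) k a b) f ⟨x, μ⟩) * supNorm f := by
  classical
  obtain ⟨δ, M, hδ, hM1, hHB⟩ := exists_HB_allTori_of_prop12Printed (le_trans one_le_two hd) hL ha h12
  obtain ⟨MC, δ₀, hMC, hδ₀, HC⟩ := cloc_estimates d L hd
  obtain ⟨C, hC0, hCζ⟩ := exists_cutoffProfile_lipschitz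
  have hδC : 0 < δ₀ / 2 := half_pos hδ₀
  have hM : 0 ≤ M := zero_le_one.trans hM1
  refine ⟨(1 + 16 * C / ρ₀) * (Real.exp (δ / 2) + 2) * (M ^ 2 * (MC * (Real.exp (4 * δ₀ * L) * (1 + L) ^ 2)) * (d : ℝ) ^ 3 *
      (Real.exp (min (δ / 2) (δ₀ / 2) / 2 / 2) * ((2 * (1 + d / (min (δ / 2) (δ₀ / 2) / 2))) ^ d) ^ 3)),
    min (δ / 32) (δ₀ / 2 / 4), min (δ / 2) (δ₀ / 2) / 2, lt_min (by positivity) (by positivity),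
    half_pos (lt_min (half_pos hδ) hδC), by positivity, fun P hPd hPL k hk ρ hρ hmono f x μ lam => ?_⟩
  subst hPd; subst hPL
  have hH : ∀ (j : ℕ) (hj : j ≤ P.m + P.K), j < k → ∀ (μ ν : Fin P.d) (x'' : TSite P 0) (y : TSite P j),
      |(torusRep P j (deltaAData hj a)).H (x'', μ) (y, ν)| ≤ M * Real.exp (-(δ * distEU P j x'' y)) :=
    fun j hj _ μ ν x'' y => (hHB P rfl rfl j hj μ ν x'' y).1
  have hB : ∀ (j : ℕ) (hj : j ≤ P.m + P.K), j < k → ∀ (μ ν : Fin P.d) (x'' : TSite P 0) (y : TSite P j),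
      ‖fun lam : Fin P.d => (P.L : ℝ) ^ j *
          ((torusRep P j (deltaAData hj a)).H (x''.shift lam, μ) (y, ν) - (torusRep P j (deltaAData hj a)).H (x'', μ) (y, ν))‖ ≤
        M * Real.exp (-(δ * distEU P j x'' y)) :=
    fun j hj _ μ ν x'' y => (hHB P rfl rfl j hj μ ν x'' y).2
  have hC : ∀ j < k, (∀ b₁ b₂ : PBond P j, |Cmat P j b₁ b₂| ≤
        MC * (Real.exp (4 * δ₀ * P.L) * (1 + P.L) ^ 2) * Real.exp (-(δ₀ / 2 * (supDist b₁.src b₂.src : ℝ)))) ∧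
      (∀ b₁ b₂ : PBond P j, |Cloc P j (ρ j / 4) b₁ b₂| ≤
        MC * (Real.exp (4 * δ₀ * P.L) * (1 + P.L) ^ 2) * Real.exp (-(δ₀ / 2 * (supDist b₁.src b₂.src : ℝ)))) ∧
      (∀ b₁ b₂ : PBond P j, |Cloc P j (ρ j / 4) b₁ b₂ - Cmat P j b₁ b₂| ≤
        MC * (Real.exp (4 * δ₀ * P.L) * (1 + P.L) ^ 2) * Real.exp (-(δ₀ / 2 / 4 * ρ j)) *
          Real.exp (-(δ₀ / 2 * (supDist b₁.src b₂.src : ℝ)))) :=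
    fun j hjk => cSide_of_cloc_estimates hMC hδ₀ (fun R b b' => HC P rfl rfl j inferInstance (by omega) R b b') (ρ j)
  rw [neg_mul]
  exact (abs_apply_gradDkSubDkLoc_le hd hk ha hδ hδC hM (by positivity) hH hB hC0 hCζ ρ hρ₀ hρ hmono (fun j hjk => (hC j hjk).1)
    (fun j hjk => (hC j hjk).2.1) (fun j hjk => (hC j hjk).2.2) f x μ lam).trans (le_of_eq (by ring))

/-- **THE `η`-DERIVATIVE OF THE OPERATOR CLOSENESS OVER ALL TORI, HYPOTHESIS-FREE** (`2 ≤ d`, `L` odd `> 1`, radii `ρ_j ≥ ρ₀ > 0`): ONE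
`(c₀, c, δ′)` for every torus, every `k ≤ m + K`, every admissible schedule, every `f, x, μ, λ` — §4's theorem with [6I] Prop. 1.2 supplied by
p19's `prop12Printed_allTori` (at `a = 1`). [cite: BalabanImbrieJaffe1988, (2.13) p.261] -/
theorem opCloseGrad_dkLoc_allTori {d L : ℕ} (hd : 2 ≤ d) (hL : Odd L ∧ 1 < L) {ρ₀ : ℝ} (hρ₀ : 0 < ρ₀) :
    ∃ c₀ c δ' : ℝ, 0 < c ∧ 0 < δ' ∧ 0 ≤ c₀ ∧ ∀ (P : Params) (_ : P.d = d) (_ : P.L = L) (k : ℕ) (_ : k ≤ P.m + P.K)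
      (ρ : ℕ → ℝ), (∀ j < k, ρ₀ ≤ ρ j) → (∀ j < k, ρ k ≤ ρ j) → ∀ (f : PBond P 0 → ℝ) (x : TSite P 0) (μ lam : Fin P.d),
        (P.L : ℝ) ^ k * |applyK (fun b b'' => (P.eta k) ^ P.d * (DkE P ((P.eta k) ^ P.d) ((P.L : ℝ) ^ k) k (toE P (Pi.single b'' 1)) b -
              dkLocKer (P := P) ((P.eta k) ^ P.d) ((P.L : ℝ) ^ k) ρ k b b'')) f ⟨x.shift lam, μ⟩ -
            applyK (fun b b'' => (P.eta k) ^ P.d * (DkE P ((P.eta k) ^ P.d) ((P.L : ℝ) ^ k) k (toE P (Pi.single b'' 1)) b -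
              dkLocKer (P := P) ((P.eta k) ^ P.d) ((P.L : ℝ) ^ k) ρ k b b'')) f ⟨x, μ⟩| ≤
          c₀ * Real.exp (-(c * ρ k)) * Real.exp (-δ' * suppDist (fun a b => kdist (P := P) k a b) f ⟨x, μ⟩) * supNorm f :=
  opCloseGrad_dkLoc_allTori_of_prop12Printed hd hL one_pos (prop12Printed_allTori d L one_pos) hρ₀

end

/-! ## §5  (v1.2) At the PRINTED radius schedule `ρ_j = r(e_j) = |log e_j⁻¹|^r` — `ρ₀ = 1` for small charge

§§3–4 take a LOWER BOUND `ρ₀ > 0` of the radii (the constants carry `1/ρ₀` from the Lipschitz cutoff).  At the printed schedule (2.2)–(2.3)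
(r18's `rSched`: `r(e_j) = |log e_j⁻¹|^r`, `e_j = (L^jε)^{(4−d)/2}e`) and for small charge at scale `k` in the form `log e_k⁻¹ ≥ 1` (i.e.
`e_k ≤ e⁻¹`), one has `r(e_k) ≥ 1` (`r ≥ 0`) and `r(e_j) ≥ r(e_k)` for `j ≤ k` (r18's `rSched_anti`, `d ≤ 4`), so `ρ₀ = 1` serves for every
torus, scale and `(ε, e, r)` at once: the `η`-derivative of the operator closeness holds at the printed schedule with the printed smallness
`e^{−c·r(e_k)}` and ONE set of constants, NO schedule hypothesis left (value member: `BIJ88OpCloseDkLocTorus` §5). -/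

section RSched

open BIJ88Sect2Statements (eK rLen)
open BIJ88CurlyDkLocCloseTorus (rSched_pos_of_le rSched_anti)

variable {P : Params}

/-- `r(e_k) = |log e_k⁻¹|^r ≥ 1` once `log e_k⁻¹ ≥ 1` and `r ≥ 0`. [cite: BalabanImbrieJaffe1988, (2.3) p.260] -/
theorem one_le_rSched {L ε e r : ℝ} (hr : 0 ≤ r) {d k : ℕ} (hℓ : 1 ≤ Real.log (eK L ε e d k)⁻¹) :
    1 ≤ rSched L ε e r d k := by
  unfold rSched rLen
  exact Real.one_le_rpow (le_trans hℓ (le_abs_self _)) hr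

/-- **THE `η`-DERIVATIVE OF THE OPERATOR CLOSENESS ON EVERY TORUS AT THE PRINTED SCHEDULE `ρ_j = r(e_j)`** (`2 ≤ d ≤ 4`): there are
`c₀ ≥ 0`, `c, δ′ > 0` such that for every `k ≤ m + K`, every `ε, e > 0`, `r ≥ 0` with `log e_k⁻¹ ≥ 1` and all `f, x, μ, λ`:
`L^k·|((𝒟_k − 𝒟_{k,loc})f)(⟨x+e_λ,μ⟩) − ((𝒟_k − 𝒟_{k,loc})f)(⟨x,μ⟩)| ≤ c₀·e^{−c·r(e_k)}·e^{−δ′dist_k(suppt f,⟨x,μ⟩)}‖f‖_∞` — §3's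
`opCloseGrad_dkLoc_torus` at `ρ₀ = 1`, the two schedule hypotheses supplied by `one_le_rSched` + r18's `rSched_anti`.
[cite: BalabanImbrieJaffe1988, (2.13) p.261 with (2.2)–(2.3) p.260] -/
theorem opCloseGrad_dkLoc_torus_rSched (hd : 2 ≤ P.d) (hd4 : P.d ≤ 4) :
    ∃ c₀ c δ' : ℝ, 0 < c ∧ 0 < δ' ∧ 0 ≤ c₀ ∧ ∀ (k : ℕ) (_ : k ≤ P.m + P.K) (ε e r : ℝ), 0 < ε → 0 < e → 0 ≤ r →
      1 ≤ Real.log (eK (P.L : ℝ) ε e P.d k)⁻¹ → ∀ (f : PBond P 0 → ℝ) (x : TSite P 0) (μ lam : Fin P.d),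
        (P.L : ℝ) ^ k * |applyK (fun b b'' => (P.eta k) ^ P.d * (DkE P ((P.eta k) ^ P.d) ((P.L : ℝ) ^ k) k (toE P (Pi.single b'' 1)) b -
              dkLocKer (P := P) ((P.eta k) ^ P.d) ((P.L : ℝ) ^ k) (rSched (P.L : ℝ) ε e r P.d) k b b'')) f ⟨x.shift lam, μ⟩ -
            applyK (fun b b'' => (P.eta k) ^ P.d * (DkE P ((P.eta k) ^ P.d) ((P.L : ℝ) ^ k) k (toE P (Pi.single b'' 1)) b -
              dkLocKer (P := P) ((P.eta k) ^ P.d) ((P.L : ℝ) ^ k) (rSched (P.L : ℝ) ε e r P.d) k b b'')) f ⟨x, μ⟩| ≤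
          c₀ * Real.exp (-(c * rSched (P.L : ℝ) ε e r P.d k)) *
            Real.exp (-δ' * suppDist (fun a b => kdist (P := P) k a b) f ⟨x, μ⟩) * supNorm f := by
  obtain ⟨c₀, c, δ', hc, hδ', hc₀, H⟩ := opCloseGrad_dkLoc_torus (P := P) hd one_pos
  have hL : (1 : ℝ) ≤ P.L := by exact_mod_cast P.hL.2.le
  refine ⟨c₀, c, δ', hc, hδ', hc₀, fun k hk ε e r hε he hr hℓ f x μ lam => ?_⟩
  have hℓ0 : 0 < Real.log (eK (P.L : ℝ) ε e P.d k)⁻¹ := lt_of_lt_of_le one_pos hℓ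
  have h1 : 1 ≤ rSched (P.L : ℝ) ε e r P.d k := one_le_rSched hr hℓ
  exact H k hk _ (fun j hj => le_trans h1 (rSched_anti hL hε he hr hd4 hj.le hℓ0))
    (fun j hj => rSched_anti hL hε he hr hd4 hj.le hℓ0) f x μ lam

/-- **THE SAME OVER ALL TORI — ONE SET OF CONSTANTS, NO HYPOTHESIS** (`2 ≤ d ≤ 4`, `L` odd `> 1`): ONE `(c₀, c, δ′)` for EVERY torus `P`
(`P.d = d`, `P.L = L`), every `k ≤ m + K`, every `ε, e > 0`, `r ≥ 0` with `log e_k⁻¹ ≥ 1`, every `f, x, μ, λ` — §4's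
`opCloseGrad_dkLoc_allTori` at `ρ₀ = 1` and the printed schedule. [cite: BalabanImbrieJaffe1988, (2.13) p.261 with (2.2)–(2.3) p.260] -/
theorem opCloseGrad_dkLoc_allTori_rSched {d L : ℕ} (hd : 2 ≤ d) (hd4 : d ≤ 4) (hL : Odd L ∧ 1 < L) :
    ∃ c₀ c δ' : ℝ, 0 < c ∧ 0 < δ' ∧ 0 ≤ c₀ ∧ ∀ (P : Params) (_ : P.d = d) (_ : P.L = L) (k : ℕ) (_ : k ≤ P.m + P.K)
      (ε e r : ℝ), 0 < ε → 0 < e → 0 ≤ r → 1 ≤ Real.log (eK (P.L : ℝ) ε e P.d k)⁻¹ →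
      ∀ (f : PBond P 0 → ℝ) (x : TSite P 0) (μ lam : Fin P.d),
        (P.L : ℝ) ^ k * |applyK (fun b b'' => (P.eta k) ^ P.d * (DkE P ((P.eta k) ^ P.d) ((P.L : ℝ) ^ k) k (toE P (Pi.single b'' 1)) b -
              dkLocKer (P := P) ((P.eta k) ^ P.d) ((P.L : ℝ) ^ k) (rSched (P.L : ℝ) ε e r P.d) k b b'')) f ⟨x.shift lam, μ⟩ -
            applyK (fun b b'' => (P.eta k) ^ P.d * (DkE P ((P.eta k) ^ P.d) ((P.L : ℝ) ^ k) k (toE P (Pi.single b'' 1)) b -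
              dkLocKer (P := P) ((P.eta k) ^ P.d) ((P.L : ℝ) ^ k) (rSched (P.L : ℝ) ε e r P.d) k b b'')) f ⟨x, μ⟩| ≤
          c₀ * Real.exp (-(c * rSched (P.L : ℝ) ε e r P.d k)) *
            Real.exp (-δ' * suppDist (fun a b => kdist (P := P) k a b) f ⟨x, μ⟩) * supNorm f := by
  obtain ⟨c₀, c, δ', hc, hδ', hc₀, H⟩ := opCloseGrad_dkLoc_allTori hd hL one_pos
  refine ⟨c₀, c, δ', hc, hδ', hc₀, fun P hPd hPL k hk ε e r hε he hr hℓ f x μ lam => ?_⟩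
  have hL1 : (1 : ℝ) ≤ P.L := by exact_mod_cast P.hL.2.le
  have hd4' : P.d ≤ 4 := hPd ▸ hd4
  have hℓ0 : 0 < Real.log (eK (P.L : ℝ) ε e P.d k)⁻¹ := lt_of_lt_of_le one_pos hℓ
  have h1 : 1 ≤ rSched (P.L : ℝ) ε e r P.d k := one_le_rSched hr hℓ
  exact H P hPd hPL k hk _ (fun j hj => le_trans h1 (rSched_anti hL1 hε he hr hd4' hj.le hℓ0))
    (fun j hj => rSched_anti hL1 hε he hr hd4' hj.le hℓ0) f x μ lam

end RSched

end Literature.MathematicalPhysics.QuantumFieldTheory.BalabanImbrieJaffe1984to88.BIJ88OpCloseDkLocGradTorus
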